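import Literature.MathematicalPhysics.QuantumFieldTheory.Federbush1986.PhaseCellIVThmA1Submanifold
import Literature.MathematicalPhysics.QuantumFieldTheory.Federbush1986.PhaseCellIVThmA34Submanifold

/-!
# Federbush, *A phase cell approach to Yang–Mills theory. IV. The choice of variables* (CMP **114** (1988) 317–343) —
# Appendix A, Theorems A.1 and A.2 in the INTRINSIC (induced Riemannian length) metric of the target `M ⊂ Rᵗ`:
# the passage between print's Riemannian distance `d` on `M` and the ambient distance of `Rᵗ`, PROVED

statement-level skeleton of published theorems with citation tags; proofs where landed; nothing here is a claim about the Yang–Mills mass gap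

Cell `lit-balaban`, reader/typer block **r19** (F4 fold owner); SKELETON rows `F4.ThmA.1`, `F4.ThmA.2` (and `F4.EqA.9-A.16`) of
`run/shared/lean/pub/lit-balaban/lit-balaban-r19/ROWS-F4.md`; this file answers the fold owner's question Q-r19-1 (are the
'embedded readings' `ThmA1Emb` / `ThmA2Emb` readings of record?) by a theorem instead of a ruling.

**Source.** P. Federbush, Commun. Math. Phys. **114** (1988) 317–343 [bib `Federbush1988PhaseCellIV`], Appendix A pp. 339–341
(journal page = PDF page + 316; renders `lit-balaban-r19/renders/f4/f4-p023…p025.png`, text layer `paper:doi-10-1007-bf01225039`).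

**The point.** Theorems A.1/A.2 are printed for «Let `M` be a compact differentiable manifold (without boundary) and provided
with a Riemannian metric» (p. 339) / «… and supplied with a metric» (p. 341): the `d` in `Λ₁(φ) = Sup d(φ(x), φ(y))/|x − y|` ((11.4) p. 337)
and in `d^M(g₁, g₂) = sup_x d(g₁(x), g₂(x))` ((A.17) p. 341) is the RIEMANNIAN (geodesic) distance of `M`.  The tree proves both
theorems for every compact `C^∞` submanifold `M ⊂ Rᵗ` with the AMBIENT distance of `Rᵗ` restricted to `M` ('embedded
reading': `thmA1Emb_of_submanifold` p299964, `thmA2Emb_of_submanifold` p299476).  Print itself passes between the two metrics in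
the first paragraph of the proof of Theorem A.1 (p. 339): «one can set things up so that the inclusions of these Euclidean cubes
into `M` have universally bounded differential, and likewise the inverse mappings have universally bounded differential. Thus
if (A.2) holds for mappings into `M′ = Rˢ` for some constant `c` …, then (A.2) will hold in the context of the theorem for some
constant `c′`, …».  This file formalises that passage for the embedded target:

* `pathLength γ` = the length (total variation, Mathlib `eVariationOn`) of a path; `intrinsicEDist M x y` = the infimum of the
  lengths of the paths from `x` to `y` INSIDE `M` (the induced length metric; for a `C^∞` submanifold with the metric induced
  from `Rᵗ` this is its Riemannian distance) — an extended pseudo-distance on `M` (`= ∞` across path components), carried by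
  the type synonym `Intrinsic M` so that print's `Λ₁`, `d^M` are literally the tree's `lipConst`, `supDist` (p242861) for maps
  into `Intrinsic M`;
* `edist ≤ intrinsicEDist` (chords are shorter than paths) — so the HYPOTHESES (A.1), `d^M(f₁,f₂) ≤ ε_M` in print's metric imply
  the ambient ones, and a null-homotopy in the (finer) intrinsic topology is one in the ambient topology;
* the CONVEX-DOMAIN LEMMA `lipConst_toIntrinsic_comp_le_of_convex`: a map from a CONVEX set (`D` the unit cube, `B` the unit ball)
  into `M` has the SAME `Λ₁` in both metrics — the image of the segment `[x, y]` is a path in `M` of length `≤ Λ₁ · |x − y|`;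
  hence the CONCLUSIONS (A.2), (A.19) transfer with the same constants, for ANY set `M` (`thmA1Len_of_thmA1Emb`: no hypothesis
  on `M` at all);
* the LOCAL QUASI-CONVEXITY LEMMA `intrinsicEDist_le_of_retract`: if `M` has an `L`-Lipschitz retraction `P` of its
  `r`-neighbourhood (every compact `C^∞` submanifold does — the tubular one, `exists_smooth_retraction_euclidean` p299101), then
  `d(x, y) ≤ L|x − y|` for `x, y ∈ M` with `|x − y| < 2r` (retract the chord) — this transfers (A.18) (`thmA2Len_of_retract`,
  with `ε_M` shrunk so that `c₁ε_M < r`), and shows that on such `M` the intrinsic and ambient topologies coincide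
  (`Intrinsic.homeomorphOfRetract`, `Intrinsic.exists_homeomorph_of_submanifold`), so that «homotopically trivial» means the
  same in both readings;
* COROLLARIES: `thmA1Len_of_submanifold`, `thmA2Len_of_submanifold` — Theorems A.1 (every cap `c₁`) and A.2 for every compact
  `C^∞` submanifold `M ⊂ Rᵗ` equipped with its intrinsic Riemannian distance, every cube/ball dimension `n`; the model targets
  `S^{t−1}` (`U(1) = S¹`, `SU(2) = S³`) hypothesis-free.
* v1.1 (§§8–9, APPEND-ONLY): the same transfer for §11 Geometric Constructions 1–4 ((11.4)–(11.8), p. 338), whose `d`, `Λ₁`,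
  `d^g` live on the gauge group `G` with its (bi-invariant Riemannian) distance: `GeomConstruction1Len` … `GeomConstruction4Len`
  (= the tree's `GeomConstruction1` p264612, `GeomConstruction2` p264612, `GeomConstruction3` p299713, `GeomConstruction4` p266275
  with target `Intrinsic M`); Constructions 1 and 3 transfer for EVERY `M` (convex edge / cube), 2 and 4 for uniformly
  Lipschitz-retractable `M`; all four for every compact (connected, for Construction 1) `C^∞` submanifold, and the six-statement
  bundle `appA12_and_geomConstructions1234Len_of_submanifold`.
* v1.3 (§10, APPEND-ONLY): the RECORD decls `ThmA1 n I M` / `ThmA2 n I M` themselves (abstract compact Riemannian manifold in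
  Mathlib's `IsRiemannianManifold` context, p242861) PROVED for every `M` admitting an `IsMetricEmbedding` — a map onto a compact
  `C^∞` submanifold of some `Rᵗ` that is an isometry for the intrinsic metric of the image (`thmA1_of_isMetricEmbedding`,
  `thmA2_of_isMetricEmbedding`); the Nash–Günther theorem says every compact Riemannian manifold has one (kept as a hypothesis).
* v1.4 (§10 tail + §11, APPEND-ONLY): a compact `M` with an `IsMetricEmbedding` is homeomorphic to its image with the AMBIENT
  topology (`IsMetricEmbedding.isClosedEmbedding`, `homeomorphRange`: «homotopically trivial» reads the same abstractly and
  embedded); and Theorems A.3/A.4 — the capped continuous re-typings of record `ThmA3ContCap`/`ThmA4ContCap` — with `Λ₁(f)` in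
  print's metric (`ThmA3LenCap`, `ThmA4LenCap`; implied by the chordal forms for EVERY `M`, same constants), so that ALL FOUR
  theorems of Appendix A hold in print's metric for every compact `C^∞` submanifold (`appA_len_of_submanifold`).

What is NOT here: the record decls `ThmA1 n I M` / `ThmA2 n I M` (p242861) quantify over an ABSTRACT compact Riemannian manifold
in Mathlib's `IsRiemannianManifold` context; reaching them from this file UNCONDITIONALLY (§10 reaches them under an explicit
metric-embedding hypothesis) needs an isometric embedding theorem (Nash 1956,
Günther 1989: every compact Riemannian manifold is a `C^∞` submanifold of some `Rᵗ` with the induced metric), which is not in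
Mathlib and is not formalised here.  Also not here: that `intrinsicEDist` (an infimum over continuous paths of finite length)
coincides with Mathlib's `riemannianEDist` (an infimum over `C¹` paths) for a submanifold chart structure — both are the
standard induced length metric; only the former is used.
-/

namespace Literature.MathematicalPhysics.QuantumFieldTheory.Federbush1986

noncomputable section

open scoped NNReal ENNReal unitInterval
open Set Metric

namespace PhaseCellIVAppA

/-! ## 1. The length of a path (total variation of its `[0, 1]`-parametrisation) -/

section PathLength

variable {E F : Type*} [PseudoEMetricSpace E] [PseudoEMetricSpace F] {x y z : E}

/-- The LENGTH of a path `γ` from `x` to `y`: the total variation `Sup Σ d(γ(t_{i+1}), γ(t_i))` of its parametrisation on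
`[0, 1]` (Mathlib `eVariationOn`, in `ℝ≥0∞`; `∞` for a non-rectifiable path).  This is the length whose infimum over paths in `M`
is the Riemannian distance `d` of print's `M` («provided with a Riemannian metric», p. 339).
[cite: Federbush1988PhaseCellIV, Appendix A p. 339; (A.22) p. 341] -/
def pathLength (γ : Path x y) : ℝ≥0∞ := eVariationOn γ.extend (Icc 0 1)

/-- A chord is not longer than a path: `d_E(x, y) ≤ length(γ)`. [cite: Federbush1988PhaseCellIV, Appendix A p. 339] -/
theorem edist_le_pathLength (γ : Path x y) : edist x y ≤ pathLength γ := by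
  unfold pathLength
  have h := eVariationOn.edist_le γ.extend (s := Icc (0 : ℝ) 1) (x := 0) (y := 1)
    ⟨le_rfl, zero_le_one⟩ ⟨zero_le_one, le_rfl⟩
  simpa only [Path.extend_zero, Path.extend_one] using h

/-- The constant path has length `0`. [cite: Federbush1988PhaseCellIV, Appendix A p. 339] -/
theorem pathLength_refl (x : E) : pathLength (Path.refl x) = 0 := by
  refine eVariationOn.constant_on ?_
  rintro _ ⟨s, -, rfl⟩ _ ⟨s', -, rfl⟩
  simp [Path.refl_extend]

/-- Reversing a path does not increase its length. [cite: Federbush1988PhaseCellIV, Appendix A p. 339] -/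
theorem pathLength_symm_le (γ : Path x y) : pathLength γ.symm ≤ pathLength γ := by
  unfold pathLength
  rw [Path.extend_symm]
  exact eVariationOn.comp_le_of_antitoneOn γ.extend (fun s : ℝ => 1 - s)
    (fun a _ b _ hab => by linarith)
    (fun s hs => ⟨by linarith [hs.2], by linarith [hs.1]⟩)

/-- The length of a concatenation is at most the sum of the lengths (in fact equal).
[cite: Federbush1988PhaseCellIV, Appendix A p. 339] -/
theorem pathLength_trans_le (γ₁ : Path x y) (γ₂ : Path y z) :
    pathLength (γ₁.trans γ₂) ≤ pathLength γ₁ + pathLength γ₂ := by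
  unfold pathLength
  have hsplit := eVariationOn.Icc_add_Icc (γ₁.trans γ₂).extend (s := Icc (0 : ℝ) 1) (a := 0) (b := 1 / 2) (c := 1)
    (by norm_num) (by norm_num) (by norm_num)
  have h1 : Icc (0 : ℝ) 1 ∩ Icc 0 (1 / 2) = Icc 0 (1 / 2) := by
    rw [Icc_inter_Icc]; norm_num
  have h2 : Icc (0 : ℝ) 1 ∩ Icc (1 / 2) 1 = Icc (1 / 2) 1 := by
    rw [Icc_inter_Icc]; norm_num
  rw [inter_self, h1, h2] at hsplit
  rw [← hsplit]
  gcongr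
  · calc eVariationOn (γ₁.trans γ₂).extend (Icc 0 (1 / 2))
        = eVariationOn (γ₁.extend ∘ fun s : ℝ => 2 * s) (Icc 0 (1 / 2)) :=
          eVariationOn.congr fun s hs => by
            simp only [Function.comp_apply, Path.extend_trans_of_le_half _ _ hs.2]
      _ ≤ eVariationOn γ₁.extend (Icc 0 1) :=
          eVariationOn.comp_le_of_monotoneOn _ _ (fun a _ b _ hab => by linarith)
            (fun s hs => ⟨by linarith [hs.1], by linarith [hs.2]⟩)
  · calc eVariationOn (γ₁.trans γ₂).extend (Icc (1 / 2) 1)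
        = eVariationOn (γ₂.extend ∘ fun s : ℝ => 2 * s - 1) (Icc (1 / 2) 1) :=
          eVariationOn.congr fun s hs => by
            simp only [Function.comp_apply, Path.extend_trans_of_half_le _ _ hs.1]
      _ ≤ eVariationOn γ₂.extend (Icc 0 1) :=
          eVariationOn.comp_le_of_monotoneOn _ _ (fun a _ b _ hab => by linarith)
            (fun s hs => ⟨by linarith [hs.1], by linarith [hs.2]⟩)

/-- Changing the endpoints' names (`Path.cast`) does not change the length. [cite: Federbush1988PhaseCellIV, Appendix A p. 339] -/
theorem pathLength_cast (γ : Path x y) {x' y' : E} (hx : x' = x) (hy : y' = y) :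
    pathLength (γ.cast hx hy) = pathLength γ := rfl

/-- On `[0, 1]` the extension of the image path `f ∘ γ` is `f ∘ (extension of γ)`.
[cite: Federbush1988PhaseCellIV, Appendix A p. 339] -/
theorem extend_map'_eqOn (γ : Path x y) {f : E → F} (hf : ContinuousOn f (range γ)) :
    EqOn (γ.map' hf).extend (f ∘ γ.extend) (Icc 0 1) := fun s hs => by
  simp only [Path.extend_apply _ hs, Function.comp_apply]
  rfl

/-- A map which is `C`-Lipschitz on a set containing the path multiplies lengths by at most `C` (print, p. 339: «universally
bounded differential»). [cite: Federbush1988PhaseCellIV, Appendix A p. 339] -/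
theorem pathLength_map'_le {f : E → F} {C : ℝ≥0} {U : Set E} (hf : LipschitzOnWith C f U) (γ : Path x y)
    (hγ : range γ ⊆ U) :
    pathLength (γ.map' (hf.continuousOn.mono hγ)) ≤ C * pathLength γ := by
  unfold pathLength
  rw [eVariationOn.congr (extend_map'_eqOn γ _)]
  refine hf.comp_eVariationOn_le fun s _ => hγ ?_
  rw [← Path.extend_range]
  exact mem_range_self s

/-- Same for an everywhere `C`-Lipschitz map and `Path.map`. [cite: Federbush1988PhaseCellIV, Appendix A p. 339] -/
theorem pathLength_map_le {f : E → F} {C : ℝ≥0} (hf : LipschitzWith C f) (γ : Path x y) :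
    pathLength (γ.map hf.continuous) ≤ C * pathLength γ :=
  pathLength_map'_le hf.lipschitzOnWith γ (subset_univ _)

end PathLength

/-! ## 2. Segments: the unit cube `D` and the ball `B` are convex, and a segment has length `|x − y|` -/

section Segment

variable {V : Type*} [NormedAddCommGroup V] [NormedSpace ℝ V]

/-- The variation of the affine parametrisation `s ↦ x + s·v` of a segment on `[0, 1]` is at most `|v|` (segments in the convex
domains «`D = {0 ≤ x_i ≤ 1}`» p. 339 and `B` p. 341). [cite: Federbush1988PhaseCellIV, Theorem A.1 p. 339] -/
theorem eVariationOn_lineMap_le (x v : V) :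
    eVariationOn (fun s : ℝ => x + s • v) (Icc 0 1) ≤ (‖v‖₊ : ℝ≥0∞) := by
  have hL : LipschitzWith ‖v‖₊ (fun s : ℝ => x + s • v) := by
    refine LipschitzWith.of_dist_le_mul fun s s' => ?_
    rw [dist_eq_norm, add_sub_add_left_eq_sub, ← sub_smul, norm_smul, Real.norm_eq_abs, coe_nnnorm,
      Real.dist_eq, mul_comm]
  have h1 := (hL.lipschitzOnWith (s := univ)).comp_eVariationOn_le (g := id) (s := Icc (0 : ℝ) 1) (mapsTo_univ _ _)
  have h2 : eVariationOn (id : ℝ → ℝ) (Icc 0 1) ≤ 1 := by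
    have h := MonotoneOn.eVariationOn_le (monotone_id.monotoneOn (univ : Set ℝ)) (mem_univ (0 : ℝ)) (mem_univ 1)
    rw [univ_inter] at h
    simpa using h
  calc eVariationOn (fun s : ℝ => x + s • v) (Icc 0 1)
      = eVariationOn ((fun s : ℝ => x + s • v) ∘ id) (Icc 0 1) := rfl
    _ ≤ ‖v‖₊ * eVariationOn (id : ℝ → ℝ) (Icc 0 1) := h1
    _ ≤ ‖v‖₊ * 1 := by gcongr
    _ = (‖v‖₊ : ℝ≥0∞) := mul_one _

/-- The straight segment from `x` to `y` (the chord of two points of `M ⊂ Rᵗ`), as a path in the ambient space.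
[cite: Federbush1988PhaseCellIV, Appendix A p. 339; (A.22) p. 341] -/
def linePath (x y : V) : Path x y where
  toFun s := x + (s : ℝ) • (y - x)
  continuous_toFun := by fun_prop
  source' := by simp
  target' := by simp

/-- The chord has length at most `|x − y|`. [cite: Federbush1988PhaseCellIV, Appendix A p. 339] -/
theorem pathLength_linePath_le (x y : V) : pathLength (linePath x y) ≤ edist x y := by
  unfold pathLength
  calc eVariationOn (linePath x y).extend (Icc 0 1)
      = eVariationOn (fun s : ℝ => x + s • (y - x)) (Icc 0 1) :=
        eVariationOn.congr fun s hs => by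
          simp only [Path.extend_apply _ hs]
          rfl
    _ ≤ (‖y - x‖₊ : ℝ≥0∞) := eVariationOn_lineMap_le _ _
    _ = edist x y := by rw [edist_comm, edist_nndist, nndist_eq_nnnorm]

variable {S : Set V}

/-- The straight segment from `x` to `y` inside a CONVEX set `S`, as a path in `S` (the domains `D` (unit cube) and `B` (unit
ball) of Theorems A.1–A.4 are convex). [cite: Federbush1988PhaseCellIV, Theorem A.1 p. 339; Theorem A.2 p. 341] -/
def segPath (hS : Convex ℝ S) (x y : ↥S) : Path x y where
  toFun s := ⟨(x : V) + (s : ℝ) • ((y : V) - x), hS.add_smul_sub_mem x.2 y.2 ⟨s.2.1, s.2.2⟩⟩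
  continuous_toFun := by
    apply Continuous.subtype_mk
    fun_prop
  source' := by ext; simp
  target' := by ext; simp

/-- The segment path has length at most `|x − y|`. [cite: Federbush1988PhaseCellIV, Theorem A.1 p. 339] -/
theorem pathLength_segPath_le (hS : Convex ℝ S) (x y : ↥S) : pathLength (segPath hS x y) ≤ edist x y := by
  unfold pathLength
  calc eVariationOn (segPath hS x y).extend (Icc 0 1)
      = eVariationOn (Subtype.val ∘ (segPath hS x y).extend) (Icc 0 1) := rfl
    _ = eVariationOn (fun s : ℝ => (x : V) + s • ((y : V) - x)) (Icc 0 1) :=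
        eVariationOn.congr fun s hs => by
          simp only [Function.comp_apply, Path.extend_apply _ hs]
          rfl
    _ ≤ (‖(y : V) - x‖₊ : ℝ≥0∞) := eVariationOn_lineMap_le _ _
    _ = edist x y := by
        rw [Subtype.edist_eq, edist_comm, edist_nndist, nndist_eq_nnnorm]

/-- The unit cube `D = {0 ≤ x_i ≤ 1}` is convex. [cite: Federbush1988PhaseCellIV, Theorem A.1 p. 339] -/
theorem convex_unitCube (n : ℕ) : Convex ℝ (unitCube n) := by
  intro x hx y hy a b ha hb hab i
  have hxi := hx i
  have hyi := hy i
  simp only [PiLp.add_apply, PiLp.smul_apply, smul_eq_mul, mem_Icc]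
  constructor <;> nlinarith [hxi.1, hxi.2, hyi.1, hyi.2]

end Segment

/-! ## 3. The intrinsic (induced length) distance of a subset `M`, and the type `Intrinsic M` carrying it -/

section IntrinsicDist

variable {E : Type*} [PseudoEMetricSpace E]

/-- The INTRINSIC distance of the subset `M`: `d(x, y) = inf {length(γ) : γ a path from x to y inside M}` (`∞` if there is
none).  For a `C^∞` submanifold `M ⊂ Rᵗ` with the metric induced from `Rᵗ` this is its Riemannian (geodesic) distance — the `d`
of print's «compact differentiable manifold … provided with a Riemannian metric» once `M` is embedded (p. 342: «We now embed `M`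
in some Euclidean space `Rᵗ`»). [cite: Federbush1988PhaseCellIV, Appendix A p. 339; (A.22) p. 341; p. 342] -/
def intrinsicEDist (M : Set E) (x y : E) : ℝ≥0∞ := ⨅ (γ : Path x y) (_ : ∀ s, γ s ∈ M), pathLength γ

variable {M : Set E} {x y z : E}

/-- Any path inside `M` bounds the intrinsic distance. [cite: Federbush1988PhaseCellIV, Appendix A p. 339] -/
theorem intrinsicEDist_le (γ : Path x y) (hγ : ∀ s, γ s ∈ M) : intrinsicEDist M x y ≤ pathLength γ :=
  iInf₂_le γ hγ

/-- **Chord ≤ geodesic**: the ambient distance is bounded by the intrinsic one (the easy half of print's «bounded differential»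
comparison, p. 339). [cite: Federbush1988PhaseCellIV, Appendix A p. 339] -/
theorem edist_le_intrinsicEDist (M : Set E) (x y : E) : edist x y ≤ intrinsicEDist M x y :=
  le_iInf₂ fun γ _ => edist_le_pathLength γ

/-- `d(x, x) = 0` for `x ∈ M`. [cite: Federbush1988PhaseCellIV, Appendix A p. 339] -/
theorem intrinsicEDist_self (hx : x ∈ M) : intrinsicEDist M x x = 0 :=
  le_antisymm ((intrinsicEDist_le (Path.refl x) fun _ => hx).trans_eq (pathLength_refl x)) bot_le

/-- `d` is symmetric. [cite: Federbush1988PhaseCellIV, Appendix A p. 339] -/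
theorem intrinsicEDist_comm (M : Set E) (x y : E) : intrinsicEDist M x y = intrinsicEDist M y x := by
  suffices h : ∀ x y : E, intrinsicEDist M y x ≤ intrinsicEDist M x y from le_antisymm (h y x) (h x y)
  intro x y
  refine le_iInf₂ fun γ hγ => ?_
  refine (intrinsicEDist_le γ.symm fun s => ?_).trans (pathLength_symm_le γ)
  rw [Path.symm_apply]
  exact hγ _

/-- Concatenation: `d(x, z) ≤ length(γ₁) + length(γ₂)`. [cite: Federbush1988PhaseCellIV, Appendix A p. 339] -/
theorem intrinsicEDist_le_add (γ₁ : Path x y) (h₁ : ∀ s, γ₁ s ∈ M) (γ₂ : Path y z) (h₂ : ∀ s, γ₂ s ∈ M) :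
    intrinsicEDist M x z ≤ pathLength γ₁ + pathLength γ₂ := by
  have hr : range (γ₁.trans γ₂) ⊆ M := by
    rw [Path.trans_range]
    exact union_subset (range_subset_iff.2 h₁) (range_subset_iff.2 h₂)
  exact (intrinsicEDist_le (γ₁.trans γ₂) fun s => hr (mem_range_self s)).trans (pathLength_trans_le γ₁ γ₂)

/-- `d` satisfies the triangle inequality. [cite: Federbush1988PhaseCellIV, Appendix A p. 339] -/
theorem intrinsicEDist_triangle (M : Set E) (x y z : E) :
    intrinsicEDist M x z ≤ intrinsicEDist M x y + intrinsicEDist M y z := by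
  calc intrinsicEDist M x z
      ≤ ⨅ (γ₂ : Path y z) (_ : ∀ s, γ₂ s ∈ M) (γ₁ : Path x y) (_ : ∀ s, γ₁ s ∈ M), pathLength γ₁ + pathLength γ₂ :=
        le_iInf₂ fun γ₂ h₂ => le_iInf₂ fun γ₁ h₁ => intrinsicEDist_le_add γ₁ h₁ γ₂ h₂
    _ = intrinsicEDist M x y + intrinsicEDist M y z := by
        simp only [intrinsicEDist, ENNReal.iInf_add, ENNReal.add_iInf]

variable (M) in
/-- The set `M` equipped with its INTRINSIC distance: a type synonym of `↥M` whose (extended pseudo-)distance is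
`intrinsicEDist M` — print's `M` «provided with a Riemannian metric» (p. 339), as opposed to `↥M` with the ambient distance of
the embedded reading.  Maps into `Intrinsic M` have their `Λ₁` ((11.4)) and `d^M` ((A.17)) computed in print's metric by the
tree's `lipConst` / `supDist`. [cite: Federbush1988PhaseCellIV, Appendix A p. 339; (11.4) p. 337; (A.17) p. 341] -/
def Intrinsic : Type _ := ↥M

namespace Intrinsic

variable (M) in
/-- The identity `M → (M, d)` onto the intrinsic copy. [cite: Federbush1988PhaseCellIV, Appendix A p. 339] -/
def toIntrinsic (p : ↥M) : Intrinsic M := p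

variable (M) in
/-- The identity `(M, d) → M` back to the ambient copy. [cite: Federbush1988PhaseCellIV, Appendix A p. 339] -/
def ofIntrinsic (p : Intrinsic M) : ↥M := p

omit [PseudoEMetricSpace E] in
/-- The two identities are inverse to each other. [cite: Federbush1988PhaseCellIV, Appendix A p. 339] -/
@[simp] theorem ofIntrinsic_toIntrinsic (p : ↥M) : ofIntrinsic M (toIntrinsic M p) = p := rfl

omit [PseudoEMetricSpace E] in
/-- The two identities are inverse to each other. [cite: Federbush1988PhaseCellIV, Appendix A p. 339] -/
@[simp] theorem toIntrinsic_ofIntrinsic (p : Intrinsic M) : toIntrinsic M (ofIntrinsic M p) = p := rfl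

/-- `(M, d)` is an extended pseudo-metric space (`d = ∞` between different path components; when the ambient `E` is a genuine
(extended) metric space, `d(x, y) = 0 ⇒ x = y` also holds, by `edist ≤ d`, but is not needed).
[cite: Federbush1988PhaseCellIV, Appendix A p. 339] -/
instance instPseudoEMetricSpace : PseudoEMetricSpace (Intrinsic M) where
  edist p q := intrinsicEDist M ((ofIntrinsic M p : ↥M) : E) ((ofIntrinsic M q : ↥M) : E)
  edist_self p := intrinsicEDist_self (ofIntrinsic M p).2
  edist_comm p q := intrinsicEDist_comm M _ _
  edist_triangle p q o := intrinsicEDist_triangle M _ _ _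

/-- The distance of `(M, d)` is the intrinsic distance. [cite: Federbush1988PhaseCellIV, Appendix A p. 339] -/
theorem edist_def (p q : Intrinsic M) :
    edist p q = intrinsicEDist M ((ofIntrinsic M p : ↥M) : E) ((ofIntrinsic M q : ↥M) : E) := rfl

/-- The distance of `(M, d)` between two points of `M`. [cite: Federbush1988PhaseCellIV, Appendix A p. 339] -/
theorem edist_toIntrinsic (p q : ↥M) :
    edist (toIntrinsic M p) (toIntrinsic M q) = intrinsicEDist M (p : E) (q : E) := rfl

/-- The identity `(M, d) → (M, |·|)` is `1`-Lipschitz (chord ≤ geodesic). [cite: Federbush1988PhaseCellIV, Appendix A p. 339] -/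
theorem lipschitzWith_ofIntrinsic : LipschitzWith 1 (ofIntrinsic M) := fun p q => by
  rw [ENNReal.coe_one, one_mul, edist_def, Subtype.edist_eq]
  exact edist_le_intrinsicEDist M _ _

/-- … hence continuous: the intrinsic topology is finer than the ambient one. [cite: Federbush1988PhaseCellIV, Appendix A p. 339] -/
theorem continuous_ofIntrinsic : Continuous (ofIntrinsic M) := lipschitzWith_ofIntrinsic.continuous

variable (M) in
/-- The identity `(M, d) → (M, |·|)` as a continuous map. [cite: Federbush1988PhaseCellIV, Appendix A p. 339] -/
def ofIntrinsicCM : C(Intrinsic M, ↥M) := ⟨ofIntrinsic M, continuous_ofIntrinsic⟩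

/-- Unfolding lemma. [cite: Federbush1988PhaseCellIV, Appendix A p. 339] -/
@[simp] theorem ofIntrinsicCM_apply (p : Intrinsic M) : ofIntrinsicCM M p = ofIntrinsic M p := rfl

end Intrinsic

open Intrinsic

/-! ### `Λ₁` and `d^M` in the two metrics -/

/-- `Λ₁` measured with the ambient distance is at most `Λ₁` measured with the intrinsic one (hypothesis (A.1) transfers).
[cite: Federbush1988PhaseCellIV, (11.4) p. 337; Theorem A.1 (A.1) p. 339] -/
theorem lipConst_ofIntrinsic_comp_le {X : Type*} [PseudoEMetricSpace X] (φ : X → Intrinsic M) :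
    lipConst (ofIntrinsic M ∘ φ) ≤ lipConst φ := by
  unfold lipConst
  gcongr with a b
  rw [Function.comp_apply, Function.comp_apply, Subtype.edist_eq, edist_def]
  exact edist_le_intrinsicEDist M _ _

/-- `d^M` measured with the ambient distance is at most `d^M` measured with the intrinsic one (hypothesis `d^M(f₁, f₂) ≤ ε_M`
of Theorem A.2 transfers). [cite: Federbush1988PhaseCellIV, (A.17) p. 341] -/
theorem supDist_ofIntrinsic_comp_le {X : Type*} (g₁ g₂ : X → Intrinsic M) :
    supDist (ofIntrinsic M ∘ g₁) (ofIntrinsic M ∘ g₂) ≤ supDist g₁ g₂ := by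
  unfold supDist
  gcongr with a
  rw [Function.comp_apply, Function.comp_apply, Subtype.edist_eq, edist_def]
  exact edist_le_intrinsicEDist M _ _

end IntrinsicDist

/-! ## 4. The convex-domain lemma: on `D` and `B`, `Λ₁` is the same in both metrics -/

section ConvexDomain

variable {E : Type*} [PseudoEMetricSpace E] {M : Set E}
variable {V : Type*} [NormedAddCommGroup V] [NormedSpace ℝ V] {S : Set V}

open Intrinsic

/-- For a map `φ` from a CONVEX set `S` into `M`, `Λ₁`-Lipschitz for the ambient distance, the image of the segment `[x, y]` is
a path in `M` of length `≤ Λ₁|x − y|`; hence the intrinsic distance `d(φ(x), φ(y)) ≤ Λ₁|x − y|`.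
[cite: Federbush1988PhaseCellIV, (11.4) p. 337; Theorem A.1 (A.2) p. 339] -/
theorem intrinsicEDist_le_of_convex (hS : Convex ℝ S) {φ : ↥S → ↥M} {K : ℝ≥0} (hφ : LipschitzWith K φ) (x y : ↥S) :
    intrinsicEDist M (φ x : E) (φ y : E) ≤ K * edist x y := by
  have hφ' : LipschitzWith K (Subtype.val ∘ φ) := fun a b => hφ a b
  let γ : Path (φ x : E) (φ y : E) := (segPath hS x y).map hφ'.continuous
  have hγM : ∀ s, γ s ∈ M := fun s => (φ _).2
  calc intrinsicEDist M (φ x : E) (φ y : E) ≤ pathLength γ := intrinsicEDist_le γ hγM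
    _ ≤ K * pathLength (segPath hS x y) := pathLength_map_le hφ' _
    _ ≤ K * edist x y := by gcongr; exact pathLength_segPath_le hS x y

/-- **Convex-domain lemma.**  For `φ : S → M` with `S` convex (the cube `D`, the ball `B`), `Λ₁` in print's intrinsic metric
is at most (hence, by `lipConst_ofIntrinsic_comp_le`, equal to) `Λ₁` in the ambient metric: conclusion (A.2) / (A.19) for the
embedded reading IS the printed conclusion. [cite: Federbush1988PhaseCellIV, (11.4) p. 337; Theorem A.1 (A.2) p. 339; (A.19) p. 341] -/
theorem lipConst_toIntrinsic_comp_le_of_convex (hS : Convex ℝ S) (φ : ↥S → ↥M) :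
    lipConst (toIntrinsic M ∘ φ) ≤ lipConst φ := by
  by_cases htop : lipConst φ = ⊤
  · rw [htop]; exact le_top
  set K : ℝ≥0 := (lipConst φ).toNNReal with hK_def
  have hK : lipConst φ = K := (ENNReal.coe_toNNReal htop).symm
  have hφ : LipschitzWith K φ := lipConst_le_iff.mp hK.le
  rw [hK]
  refine lipConst_le_iff.mpr fun a b => ?_
  rw [Function.comp_apply, Function.comp_apply, edist_toIntrinsic]
  exact intrinsicEDist_le_of_convex hS hφ a b

/-- Equality form of the convex-domain lemma. [cite: Federbush1988PhaseCellIV, (11.4) p. 337; Theorem A.1 (A.2) p. 339] -/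
theorem lipConst_toIntrinsic_comp_eq_of_convex (hS : Convex ℝ S) (φ : ↥S → ↥M) :
    lipConst (toIntrinsic M ∘ φ) = lipConst φ :=
  le_antisymm (lipConst_toIntrinsic_comp_le_of_convex hS φ) (lipConst_ofIntrinsic_comp_le (toIntrinsic M ∘ φ))

end ConvexDomain

/-! ## 5. Local quasi-convexity of a uniformly Lipschitz-retractable `M ⊂ Rᵗ` (retract the chord) -/

section Retract

variable {t : ℕ} {M : Set (EuclideanSpace ℝ (Fin t))} {r : ℝ} {L : ℝ≥0}
  {P : EuclideanSpace ℝ (Fin t) → EuclideanSpace ℝ (Fin t)}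

open Intrinsic

/-- The chord `[x, y]` of two points of `M` at distance `< 2r` stays in the open `r`-neighbourhood of `M` (where print's «normal
projection» onto `M`, p. 342, is defined). [cite: Federbush1988PhaseCellIV, Appendix A p. 339; p. 342] -/
theorem infDist_lineMap_lt {x y : EuclideanSpace ℝ (Fin t)} (hx : x ∈ M) (hy : y ∈ M) (hxy : dist x y < 2 * r)
    {s : ℝ} (hs : s ∈ Icc (0 : ℝ) 1) : infDist (x + s • (y - x)) M < r := by
  have hd : dist x y = ‖y - x‖ := by rw [dist_comm, dist_eq_norm]
  rcases le_or_gt s (1 / 2) with h | h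
  · calc infDist (x + s • (y - x)) M ≤ dist (x + s • (y - x)) x := infDist_le_dist_of_mem hx
      _ = s * ‖y - x‖ := by
          rw [dist_eq_norm, add_sub_cancel_left, norm_smul, Real.norm_eq_abs, abs_of_nonneg hs.1]
      _ < r := by nlinarith [norm_nonneg (y - x), hs.1]
  · calc infDist (x + s • (y - x)) M ≤ dist (x + s • (y - x)) y := infDist_le_dist_of_mem hy
      _ = (1 - s) * ‖y - x‖ := by
          have e : x + s • (y - x) - y = -((1 - s) • (y - x)) := by
            rw [sub_smul, one_smul]; abel
          rw [dist_eq_norm, e, norm_neg, norm_smul, Real.norm_eq_abs, abs_of_nonneg (by linarith [hs.2])]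
      _ < r := by nlinarith [norm_nonneg (y - x), hs.2]

/-- **Local quasi-convexity.**  If `P` is an `L`-Lipschitz retraction of the open `r`-neighbourhood of `M` onto `M`, then two
points of `M` at ambient distance `< 2r` have intrinsic distance `≤ L ·` ambient distance: the retracted chord `P ∘ [x, y]` is a
path in `M` of length `≤ L|x − y|` (print's «inverse mappings have universally bounded differential», p. 339; `P` = the «normal
projection» onto `M` of p. 342 for a submanifold). [cite: Federbush1988PhaseCellIV, Appendix A p. 339; p. 342] -/
theorem intrinsicEDist_le_of_retract (hPL : LipschitzOnWith L P {w | infDist w M < r})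
    (hPM : MapsTo P {w | infDist w M < r} M) (hPid : ∀ w ∈ M, P w = w)
    {x y : EuclideanSpace ℝ (Fin t)} (hx : x ∈ M) (hy : y ∈ M) (hxy : dist x y < 2 * r) :
    intrinsicEDist M x y ≤ L * edist x y := by
  -- the chord
  have hU : range (linePath x y) ⊆ {w | infDist w M < r} := by
    rintro _ ⟨s, rfl⟩
    exact infDist_lineMap_lt hx hy hxy ⟨s.2.1, s.2.2⟩
  -- the retracted chord
  let γ : Path x y := ((linePath x y).map' (hPL.continuousOn.mono hU)).cast (hPid x hx).symm (hPid y hy).symm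
  have hγM : ∀ s, γ s ∈ M := fun s => hPM (hU (mem_range_self s))
  calc intrinsicEDist M x y ≤ pathLength γ := intrinsicEDist_le γ hγM
    _ = pathLength ((linePath x y).map' (hPL.continuousOn.mono hU)) := pathLength_cast _ _ _
    _ ≤ L * pathLength (linePath x y) := pathLength_map'_le hPL _ hU
    _ ≤ L * edist x y := by
        gcongr
        exact pathLength_linePath_le x y

/-- On a uniformly Lipschitz-retractable `M` the two topologies COINCIDE: the identity `M → (M, d)` is continuous (indeed
locally `L`-Lipschitz), so `Intrinsic M ≃ₜ ↥M` — «homotopically trivial» (Theorem A.1) means the same for the two readings.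
[cite: Federbush1988PhaseCellIV, Theorem A.1 p. 339; p. 342] -/
theorem continuous_toIntrinsic_of_retract (hr : 0 < r) (hPL : LipschitzOnWith L P {w | infDist w M < r})
    (hPM : MapsTo P {w | infDist w M < r} M) (hPid : ∀ w ∈ M, P w = w) :
    Continuous (toIntrinsic M) := by
  refine continuous_iff_continuousAt.2 fun p => ?_
  rw [ContinuousAt, EMetric.tendsto_nhds]
  intro ε hε
  -- points of `M` within `min r (ε / (L + 1))` of `p`
  have hLpos : (0 : ℝ≥0∞) < L + 1 := by positivity
  have hLtop : ((L : ℝ≥0∞) + 1) ≠ ⊤ := by finiteness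
  obtain ⟨δ, hδpos, hδr, hδε⟩ : ∃ δ : ℝ≥0∞, 0 < δ ∧ δ ≤ ENNReal.ofReal r ∧ (L + 1) * δ ≤ ε := by
    refine ⟨min (ENNReal.ofReal r) (ε / (L + 1)), lt_min (by simpa using hr) (ENNReal.div_pos hε.ne' hLtop),
      min_le_left _ _, ?_⟩
    calc ((L : ℝ≥0∞) + 1) * min (ENNReal.ofReal r) (ε / (L + 1)) ≤ (L + 1) * (ε / (L + 1)) := by
          gcongr; exact min_le_right _ _
      _ = ε := ENNReal.mul_div_cancel hLpos.ne' hLtop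
  filter_upwards [Metric.eball_mem_nhds p hδpos] with q hq
  rw [Metric.mem_eball] at hq
  have hqr : dist (q : EuclideanSpace ℝ (Fin t)) (p : EuclideanSpace ℝ (Fin t)) < 2 * r := by
    have h1 : edist (q : EuclideanSpace ℝ (Fin t)) p < ENNReal.ofReal r := lt_of_lt_of_le hq hδr
    rw [edist_dist, ENNReal.ofReal_lt_ofReal_iff hr] at h1
    linarith
  calc edist (toIntrinsic M q) (toIntrinsic M p)
      = intrinsicEDist M (q : EuclideanSpace ℝ (Fin t)) p := rfl
    _ ≤ L * edist (q : EuclideanSpace ℝ (Fin t)) p := intrinsicEDist_le_of_retract hPL hPM hPid q.2 p.2 hqr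
    _ ≤ (L + 1) * edist q p := by
        rw [← Subtype.edist_eq]
        gcongr
        exact le_self_add
    _ < (L + 1) * δ := by
        rw [mul_comm ((L : ℝ≥0∞) + 1) (edist q p), mul_comm ((L : ℝ≥0∞) + 1) δ]
        exact ENNReal.mul_lt_mul_left hLpos.ne' hLtop hq
    _ ≤ ε := hδε

/-- `Intrinsic M ≃ₜ ↥M` for a uniformly Lipschitz-retractable `M` (both identities continuous).
[cite: Federbush1988PhaseCellIV, Theorem A.1 p. 339; p. 342] -/
def Intrinsic.homeomorphOfRetract (hr : 0 < r) (hPL : LipschitzOnWith L P {w | infDist w M < r})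
    (hPM : MapsTo P {w | infDist w M < r} M) (hPid : ∀ w ∈ M, P w = w) : Intrinsic M ≃ₜ ↥M where
  toFun := ofIntrinsic M
  invFun := toIntrinsic M
  left_inv _ := rfl
  right_inv _ := rfl
  continuous_toFun := continuous_ofIntrinsic
  continuous_invFun := continuous_toIntrinsic_of_retract hr hPL hPM hPid

end Retract

/-! ## 6. Theorem A.1 in the intrinsic metric -/

section ThmA1

open Intrinsic

/-- **Theorem A.1 at the cap `c₁`, INTRINSIC METRIC** — verbatim p. 339: «Let `M` be a compact differentiable manifold (without
boundary) and provided with a Riemannian metric. Let `D` be the unit `n`-cube … there is a constant `c₂ = c₂(c₁)`, such that if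
`f` is any homotopically trivial mapping from `∂D` into `M` satisfying `Λ₁(f) ≤ c₁` (A.1) there is an extension of `f`, `f^e`,
mapping `D` into `M`, satisfying `Λ₁(f^e) ≤ c₂Λ₁(f)` (A.2)».  Word for word `ThmA1EmbAt` (p265091) with the target `↥M`
(ambient distance) replaced by `Intrinsic M` (= `M ⊂ Rᵗ` with its intrinsic distance and topology — the Riemannian distance of
the induced metric when `M` is a submanifold): `Λ₁` = `lipConst` computed with `d`, «homotopically trivial» = null-homotopic as a
map into `(M, d)`.  `Prop`-valued definition.
CLASS AND IDENTIFICATION (cell ruling G.5-49 (ii)): the class for which the tree PROVES this statement is K = {compact `C^∞`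
submanifolds `M ⊂ Rᵗ` (`IsCompact M`, `IsSubmanifoldOfDim d`), with the induced intrinsic metric} (`thmA1Len_of_submanifold`), every
`n`, every cap `c₁`; print's class is P = {compact Riemannian manifolds without boundary} (p. 339); K meets P up to ISOMETRY by the
Nash (1956) / Günther (1989) isometric embedding theorem — a named classical theorem, NOT formalised here and the only
unformalised step; `Λ₁` and «homotopically trivial» are isometry-invariant. [cite: Federbush1988PhaseCellIV, Theorem A.1 (A.1)–(A.2) p. 339] -/
def ThmA1LenAt (n t : ℕ) (M : Set (EuclideanSpace ℝ (Fin t))) (c₁ : ℝ≥0) : Prop :=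
  ∃ c₂ : ℝ≥0, ∀ f : C(↥(cubeBoundary n), Intrinsic M), f.Nullhomotopic → lipConst f ≤ c₁ →
    ∃ fe : ↥(unitCube n) → Intrinsic M,
      (∀ x : ↥(cubeBoundary n), fe ⟨x.1, cubeBoundary_subset n x.2⟩ = f x) ∧
      lipConst fe ≤ c₂ * lipConst f

/-- **Theorem A.1, INTRINSIC METRIC**: «For each constant `c₁`, there is a constant `c₂ = c₂(c₁)` …» = `ThmA1LenAt` at every cap.
Class K / identification as in `ThmA1LenAt` (G.5-49 (ii)): proved for every compact `C^∞` submanifold of `Rᵗ` with its intrinsic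
metric (`thmA1Len_of_submanifold`) = print's compact Riemannian manifolds up to the Nash (1956) / Günther (1989) isometric
embedding (not formalised). [cite: Federbush1988PhaseCellIV, Theorem A.1 (A.1)–(A.2) p. 339] -/
def ThmA1Len (n t : ℕ) (M : Set (EuclideanSpace ℝ (Fin t))) : Prop :=
  ∀ c₁ : ℝ≥0, ThmA1LenAt n t M c₁

variable {n t : ℕ} {M : Set (EuclideanSpace ℝ (Fin t))} {c₁ : ℝ≥0}

/-- **Transfer, Theorem A.1, FOR EVERY SET `M ⊂ Rᵗ`**: the embedded reading at the cap `c₁` implies the intrinsic-metric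
statement at the same cap with the SAME `c₂` — hypothesis by 'chord ≤ geodesic', conclusion by the convex-domain lemma on `D`
(print p. 339: «Thus if (A.2) holds for mappings into `M′ = Rˢ` …, then (A.2) will hold in the context of the theorem»).
[cite: Federbush1988PhaseCellIV, Theorem A.1 (A.1)–(A.2) p. 339] -/
theorem thmA1LenAt_of_thmA1EmbAt (h : ThmA1EmbAt n t M c₁) : ThmA1LenAt n t M c₁ := by
  obtain ⟨c₂, hc⟩ := h
  refine ⟨c₂, fun f hf hΛ => ?_⟩
  -- the same map, seen in the ambient metric
  set f' : C(↥(cubeBoundary n), ↥M) := (ofIntrinsicCM M).comp f with hf'_def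
  have hf' : f'.Nullhomotopic := hf.comp_right _
  have hΛ' : lipConst f' ≤ lipConst f := lipConst_ofIntrinsic_comp_le (M := M) f
  obtain ⟨fe', hext, hLip⟩ := hc f' hf' (hΛ'.trans hΛ)
  refine ⟨toIntrinsic M ∘ fe', fun x => ?_, ?_⟩
  · rw [Function.comp_apply, hext x]
    rfl
  · calc lipConst (toIntrinsic M ∘ fe') ≤ lipConst fe' := lipConst_toIntrinsic_comp_le_of_convex (convex_unitCube n) fe'
      _ ≤ c₂ * lipConst f' := hLip
      _ ≤ c₂ * lipConst f := by gcongr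

/-- **Transfer, Theorem A.1 at every cap, for every set `M ⊂ Rᵗ`.** [cite: Federbush1988PhaseCellIV, Theorem A.1 (A.1)–(A.2) p. 339] -/
theorem thmA1Len_of_thmA1Emb (h : ThmA1Emb n t M) : ThmA1Len n t M := fun c₁ => thmA1LenAt_of_thmA1EmbAt (h c₁)

open Literature.AlgebraicGeometry.RealAlgebraic Literature.Analysis.Calculus in
/-- **Theorem A.1 of [Federbush1988PhaseCellIV] (every cap `c₁`, every cube dimension `n`) for every compact `C^∞` submanifold
`M ⊂ Rᵗ` PROVIDED WITH ITS INTRINSIC RIEMANNIAN DISTANCE** — the transfer applied to `thmA1Emb_of_submanifold` (p299964).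
Print's hypothesis «compact differentiable manifold (without boundary) … provided with a Riemannian metric» is met by exactly
these `M` up to isometry (Nash–Günther isometric embedding, not formalised). [cite: Federbush1988PhaseCellIV, Theorem A.1 (A.1)–(A.2) p. 339] -/
theorem thmA1Len_of_submanifold {d : ℕ} (hMc : IsCompact M) (hM : IsSubmanifoldOfDim d (EuclideanSpace.equiv (Fin t) ℝ '' M))
    (n : ℕ) : ThmA1Len n t M :=
  thmA1Len_of_thmA1Emb (thmA1Emb_of_submanifold hMc hM n)

/-- Theorem A.1 (intrinsic metric) for the MODEL TARGETS `S^{t−1} ⊂ ℝᵗ` with the great-circle distance, every `n` and `t`,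
hypothesis-free (`U(1) = S¹`, `SU(2) = S³`). [cite: Federbush1988PhaseCellIV, Theorem A.1 (A.1)–(A.2) p. 339] -/
theorem thmA1Len_sphere (n t : ℕ) : ThmA1Len n t (sphere (0 : EuclideanSpace ℝ (Fin t)) 1) :=
  thmA1Len_of_thmA1Emb (thmA1Emb_sphere n t)

end ThmA1

/-! ## 7. Theorem A.2 in the intrinsic metric -/

section ThmA2

open Intrinsic

/-- **Theorem A.2, INTRINSIC METRIC** — verbatim p. 341: «Let `M` be a compact differentiable manifold (without boundary) and
supplied with a metric. … With `B` the unit ball, we have given three maps `f₁ : ∂B → M`, `f₂ : ∂B → M`, `f₁^e : B → M`, where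
`f₁^e` is an extension of `f₁`. *If `d^M(f₁, f₂) ≤ ε_M`, with `ε_M` an absolute constant independent of the three maps, then
there is an extension `f₂^e` of `f₂` to the ball satisfying `d^M(f₁^e, f₂^e) ≤ c₁ d^M(f₁, f₂)` (A.18),
`Λ₁(f₂^e) ≤ c₂[Λ₁(f₁^e) + d^M(f₁, f₂) + Λ₁(f₂)]` (A.19), for some absolute constants `c₁` and `c₂`.*»  Word for word `ThmA2Emb`
(p263972) with the target `↥M` replaced by `Intrinsic M`: `d^M` = `supDist` and `Λ₁` = `lipConst` computed with the intrinsic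
distance `d`. `Prop`-valued definition.  CLASS AND IDENTIFICATION (G.5-49 (ii)): proved for K = {compact `C^∞` submanifolds
`M ⊂ Rᵗ` with the induced intrinsic metric} (`thmA2Len_of_submanifold`), every `n`; print's class P = {compact differentiable
manifolds without boundary «supplied with a metric»} (p. 341; Riemannian, p. 339); K meets P up to ISOMETRY by the Nash (1956) /
Günther (1989) isometric embedding theorem — NOT formalised, the only unformalised step; `d^M`, `Λ₁` are isometry-invariant.
[cite: Federbush1988PhaseCellIV, Theorem A.2 (A.17)–(A.19) p. 341] -/
def ThmA2Len (n t : ℕ) (M : Set (EuclideanSpace ℝ (Fin t))) : Prop :=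
  ∃ εM : ℝ≥0, 0 < εM ∧ ∃ c₁ c₂ : ℝ≥0,
    ∀ (f₁ f₂ : ↥(sphere (0 : EuclideanSpace ℝ (Fin n)) 1) → Intrinsic M)
      (f₁e : ↥(closedBall (0 : EuclideanSpace ℝ (Fin n)) 1) → Intrinsic M),
      (∀ x : ↥(sphere (0 : EuclideanSpace ℝ (Fin n)) 1), f₁e ⟨x.1, sphere_subset_closedBall x.2⟩ = f₁ x) →
      supDist f₁ f₂ ≤ εM →
      ∃ f₂e : ↥(closedBall (0 : EuclideanSpace ℝ (Fin n)) 1) → Intrinsic M,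
        (∀ x : ↥(sphere (0 : EuclideanSpace ℝ (Fin n)) 1), f₂e ⟨x.1, sphere_subset_closedBall x.2⟩ = f₂ x) ∧
        supDist f₁e f₂e ≤ c₁ * supDist f₁ f₂ ∧
        lipConst f₂e ≤ c₂ * (lipConst f₁e + supDist f₁ f₂ + lipConst f₂)

variable {n t : ℕ} {M : Set (EuclideanSpace ℝ (Fin t))} {r : ℝ} {L : ℝ≥0}
  {P : EuclideanSpace ℝ (Fin t) → EuclideanSpace ℝ (Fin t)}

/-- **Transfer, Theorem A.2, for a uniformly Lipschitz-retractable `M`**: the embedded reading implies the intrinsic-metric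
statement, with `ε_M` shrunk below `r/(c₁ + 1)` (so that the chords `[f₁^e(x), f₂^e(x)]`, of length `≤ c₁ d^M(f₁, f₂)`, can be
retracted: (A.18) by local quasi-convexity, constant `L c₁`), (A.19) by the convex-domain lemma on `B` (same `c₂`), the
hypothesis by 'chord ≤ geodesic'. [cite: Federbush1988PhaseCellIV, Theorem A.2 (A.17)–(A.19) p. 341; p. 342] -/
theorem thmA2Len_of_retract (hr : 0 < r) (hPL : LipschitzOnWith L P {w | infDist w M < r})
    (hPM : MapsTo P {w | infDist w M < r} M) (hPid : ∀ w ∈ M, P w = w) (h : ThmA2Emb n t M) : ThmA2Len n t M := by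
  obtain ⟨εM, hεM, c₁, c₂, H⟩ := h
  -- the shrunk `ε_M`
  set ρ : ℝ≥0 := ⟨r / (c₁ + 1), by positivity⟩ with hρ_def
  have hρpos : 0 < ρ := by
    rw [← NNReal.coe_pos]; exact div_pos hr (by positivity)
  have hc₁ρ : (c₁ : ℝ) * ρ < 2 * r := by
    have h1 : (c₁ : ℝ) * (r / (c₁ + 1)) ≤ r := by
      rw [mul_div_assoc', div_le_iff₀ (by positivity)]; nlinarith [c₁.2]
    show (c₁ : ℝ) * (r / (c₁ + 1)) < 2 * r
    linarith
  refine ⟨min εM ρ, lt_min hεM hρpos, L * c₁, c₂, fun f₁ f₂ f₁e hext hδ => ?_⟩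
  -- the same maps, seen in the ambient metric
  set f₁' : ↥(sphere (0 : EuclideanSpace ℝ (Fin n)) 1) → ↥M := ofIntrinsic M ∘ f₁
  set f₂' : ↥(sphere (0 : EuclideanSpace ℝ (Fin n)) 1) → ↥M := ofIntrinsic M ∘ f₂
  set f₁e' : ↥(closedBall (0 : EuclideanSpace ℝ (Fin n)) 1) → ↥M := ofIntrinsic M ∘ f₁e
  have hd' : supDist f₁' f₂' ≤ supDist f₁ f₂ := supDist_ofIntrinsic_comp_le f₁ f₂
  have hΛ₁' : lipConst f₁e' ≤ lipConst f₁e := lipConst_ofIntrinsic_comp_le f₁e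
  have hΛ₂' : lipConst f₂' ≤ lipConst f₂ := lipConst_ofIntrinsic_comp_le f₂
  obtain ⟨f₂e', hext', h18, h19⟩ :=
    H f₁' f₂' f₁e' (fun x => by simp only [f₁e', f₁', Function.comp_apply, hext x])
      (hd'.trans (hδ.trans (by exact_mod_cast min_le_left _ _)))
  refine ⟨toIntrinsic M ∘ f₂e', fun x => ?_, ?_, ?_⟩
  · rw [Function.comp_apply, hext' x]
    rfl
  · -- (A.18): retract the chords `[f₁e(x), f₂e(x)]`, of length `≤ c₁ d ≤ c₁ ρ < 2r`
    refine iSup_le fun x => ?_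
    have hpt : edist (f₁e' x : EuclideanSpace ℝ (Fin t)) (f₂e' x) ≤ c₁ * supDist f₁' f₂' :=
      (Subtype.edist_eq _ _).symm.trans_le ((edist_le_supDist f₁e' f₂e' x).trans h18)
    have hlt : dist (f₁e' x : EuclideanSpace ℝ (Fin t)) (f₂e' x) < 2 * r := by
      have h1 : edist (f₁e' x : EuclideanSpace ℝ (Fin t)) (f₂e' x) ≤ ((c₁ * ρ : ℝ≥0) : ℝ≥0∞) := by
        refine hpt.trans ?_
        push_cast
        gcongr
        exact hd'.trans (hδ.trans (by exact_mod_cast min_le_right _ _))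
      have h2 : nndist (f₁e' x : EuclideanSpace ℝ (Fin t)) (f₂e' x) ≤ c₁ * ρ := edist_le_coe.mp h1
      calc dist (f₁e' x : EuclideanSpace ℝ (Fin t)) (f₂e' x) = nndist (f₁e' x : EuclideanSpace ℝ (Fin t)) (f₂e' x) := rfl
        _ ≤ (c₁ : ℝ) * ρ := by exact_mod_cast h2
        _ < 2 * r := hc₁ρ
    calc edist (f₁e x) ((toIntrinsic M ∘ f₂e') x)
        = intrinsicEDist M (f₁e' x : EuclideanSpace ℝ (Fin t)) (f₂e' x) := rfl
      _ ≤ L * edist (f₁e' x : EuclideanSpace ℝ (Fin t)) (f₂e' x) :=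
          intrinsicEDist_le_of_retract hPL hPM hPid (f₁e' x).2 (f₂e' x).2 hlt
      _ ≤ L * (c₁ * supDist f₁' f₂') := by gcongr
      _ ≤ L * (c₁ * supDist f₁ f₂) := by gcongr
      _ = (L * c₁ : ℝ≥0) * supDist f₁ f₂ := by push_cast; ring
  · -- (A.19): the convex-domain lemma on the ball
    calc lipConst (toIntrinsic M ∘ f₂e')
        ≤ lipConst f₂e' := lipConst_toIntrinsic_comp_le_of_convex (convex_closedBall _ _) f₂e'
      _ ≤ c₂ * (lipConst f₁e' + supDist f₁' f₂' + lipConst f₂') := h19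
      _ ≤ c₂ * (lipConst f₁e + supDist f₁ f₂ + lipConst f₂) := by gcongr

open Literature.AlgebraicGeometry.RealAlgebraic Literature.Analysis.Calculus in
/-- **Theorem A.2 of [Federbush1988PhaseCellIV] (every ball dimension `n`) for every compact `C^∞` submanifold `M ⊂ Rᵗ`
PROVIDED WITH ITS INTRINSIC RIEMANNIAN DISTANCE** — the transfer applied to `thmA2Emb_of_retract` (p263972) with the tubular
retraction `exists_smooth_retraction_euclidean` (p299101). [cite: Federbush1988PhaseCellIV, Theorem A.2 (A.17)–(A.19) p. 341; p. 342] -/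
theorem thmA2Len_of_submanifold {d : ℕ} (hMc : IsCompact M) (hM : IsSubmanifoldOfDim d (EuclideanSpace.equiv (Fin t) ℝ '' M))
    (n : ℕ) : ThmA2Len n t M := by
  by_cases hne : M.Nonempty
  · obtain ⟨r, hr, P, -, hPM, hPid, -, L, hPL⟩ := exists_smooth_retraction_euclidean hMc hne hM
    exact thmA2Len_of_retract hr hPL (fun y hy => hPM y hy) hPid
      (thmA2Emb_of_retract hr hPL (fun y hy => hPM y hy) hPid n)
  · refine ⟨1, one_pos, 1, 1, fun f₁ f₂ f₁e _ _ => ?_⟩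
    exact absurd ⟨_, (ofIntrinsic M (f₁e ⟨0, mem_closedBall_self zero_le_one⟩)).2⟩ hne

/-- Theorem A.2 (intrinsic metric) for the MODEL TARGETS `S^{t−1} ⊂ ℝᵗ` with the great-circle distance, every `n` and `t`,
hypothesis-free (`U(1) = S¹`, `SU(2) = S³`; radial retraction of the `½`-neighbourhood, `L = 4`).
[cite: Federbush1988PhaseCellIV, Theorem A.2 (A.17)–(A.19) p. 341] -/
theorem thmA2Len_sphere (n t : ℕ) : ThmA2Len n t (sphere (0 : EuclideanSpace ℝ (Fin t)) 1) := by
  rcases Nat.lt_or_ge t 1 with ht | ht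
  · have ht0 : t = 0 := by omega
    subst ht0
    refine ⟨1, one_pos, 1, 1, fun f₁ f₂ f₁e _ _ => ?_⟩
    exfalso
    have h1 := (ofIntrinsic _ (f₁e ⟨0, mem_closedBall_self zero_le_one⟩)).2
    rw [mem_sphere_zero_iff_norm, EuclideanSpace.norm_eq, Fin.sum_univ_zero, Real.sqrt_zero] at h1
    exact zero_ne_one h1
  · obtain ⟨hL, hM, hid⟩ := ThmA2.radial_retraction_sphere ht
    exact thmA2Len_of_retract (by norm_num : (0 : ℝ) < 1 / 2) hL hM hid
      (thmA2Emb_of_retract (by norm_num : (0 : ℝ) < 1 / 2) hL hM hid n)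

/-- For compact `C^∞` submanifolds the intrinsic copy `Intrinsic M` is HOMEOMORPHIC to `↥M` by the identity (the two topologies
in which «homotopically trivial» could be read agree). [cite: Federbush1988PhaseCellIV, Theorem A.1 p. 339; p. 342] -/
theorem Intrinsic.exists_homeomorph_of_submanifold {d : ℕ} (hMc : IsCompact M)
    (hM : Literature.AlgebraicGeometry.RealAlgebraic.IsSubmanifoldOfDim d (EuclideanSpace.equiv (Fin t) ℝ '' M)) :
    ∃ e : Intrinsic M ≃ₜ ↥M, ⇑e = ofIntrinsic M := by
  by_cases hne : M.Nonempty
  · obtain ⟨r, hr, P, -, hPM, hPid, -, L, hPL⟩ :=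
      Literature.Analysis.Calculus.exists_smooth_retraction_euclidean hMc hne hM
    exact ⟨Intrinsic.homeomorphOfRetract hr hPL (fun y hy => hPM y hy) hPid, rfl⟩
  · haveI : IsEmpty (↥M) := isEmpty_coe_sort.2 (not_nonempty_iff_eq_empty.1 hne)
    have hc : Continuous (toIntrinsic M) := continuous_def.2 fun s _ => by
      rw [Set.eq_empty_of_isEmpty (toIntrinsic M ⁻¹' s)]
      exact isOpen_empty
    exact ⟨{ toFun := ofIntrinsic M, invFun := toIntrinsic M, left_inv := fun _ => rfl, right_inv := fun _ => rfl,
             continuous_toFun := continuous_ofIntrinsic, continuous_invFun := hc }, rfl⟩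

end ThmA2

/-! ## 8. (v1.1, append-only) §11 Geometric Constructions 1 and 2, (11.4)–(11.6), in the intrinsic metric of the gauge group -/

section GeomConstructions

open Intrinsic

/-- **Geometric Construction 1, (11.4) p. 337, INTRINSIC METRIC**: «We find an extension of `φ′₁(x)`, `ᵉφ′₁(x)`, to a mapping from
`e → G` (a gauge on `e`) such that a) `ᵉφ′₁(v_a)` and `ᵉφ′₁(v_b)` assume given values, b) `Λ₁(ᵉφ′₁) ≤ c · d(φ′₁(v_b), φ′₁(v_a))/L_r`»
— word for word `GeomConstruction1` (p264612) with the target `↥M` replaced by `Intrinsic M`: both `Λ₁` and the `d` on the right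
are computed with the intrinsic (bi-invariant Riemannian, for `M = G ⊆ U(N)`) distance. `Prop`-valued definition.
[cite: Federbush1988PhaseCellIV, (11.4) p. 337] -/
def GeomConstruction1Len (t : ℕ) (M : Set (EuclideanSpace ℝ (Fin t))) : Prop :=
  ∃ c : ℝ≥0, ∀ ℓ : ℝ, ∀ hℓ : 0 < ℓ, ∀ ga gb : Intrinsic M,
    ∃ φ : ↥(Icc (0 : ℝ) ℓ) → Intrinsic M,
      φ ⟨0, left_mem_Icc.mpr hℓ.le⟩ = ga ∧ φ ⟨ℓ, right_mem_Icc.mpr hℓ.le⟩ = gb ∧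
        lipConst φ ≤ c * edist ga gb / ENNReal.ofReal ℓ

/-- **Geometric Construction 2, (11.5)–(11.6) p. 337, INTRINSIC METRIC**: «a) `d^g(ᵉφ₁, ᵉφ₂) ≤ c d^g(φ₁, φ₂)` (11.5),
b) `Λ₁(ᵉφ₂) ≤ c(Λ₁(ᵉφ₁) + d^g(φ₁, φ₂)/L_r + Λ₁(φ₂))` (11.6)» — word for word `GeomConstruction2` (p264612; sup-distance form) with
the target `↥M` replaced by `Intrinsic M`. `Prop`-valued definition. [cite: Federbush1988PhaseCellIV, (11.5)–(11.6) p. 337] -/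
def GeomConstruction2Len (t : ℕ) (M : Set (EuclideanSpace ℝ (Fin t))) : Prop :=
  ∃ ε : ℝ≥0, 0 < ε ∧ ∃ c : ℝ≥0, ∀ ℓ : ℝ, 0 < ℓ →
    ∀ (φ₁ φ₂ : ↥(sphere (0 : EuclideanSpace ℝ (Fin 1)) (ℓ / 2)) → Intrinsic M)
      (eφ₁ : ↥(closedBall (0 : EuclideanSpace ℝ (Fin 1)) (ℓ / 2)) → Intrinsic M),
      (∀ x : ↥(sphere (0 : EuclideanSpace ℝ (Fin 1)) (ℓ / 2)), eφ₁ ⟨x.1, sphere_subset_closedBall x.2⟩ = φ₁ x) →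
      supDist φ₁ φ₂ ≤ ε →
      ∃ eφ₂ : ↥(closedBall (0 : EuclideanSpace ℝ (Fin 1)) (ℓ / 2)) → Intrinsic M,
        (∀ x : ↥(sphere (0 : EuclideanSpace ℝ (Fin 1)) (ℓ / 2)), eφ₂ ⟨x.1, sphere_subset_closedBall x.2⟩ = φ₂ x) ∧
        supDist eφ₁ eφ₂ ≤ c * supDist φ₁ φ₂ ∧
        lipConst eφ₂ ≤ c * (lipConst eφ₁ + supDist φ₁ φ₂ / ENNReal.ofReal ℓ + lipConst φ₂)

variable {t : ℕ} {M : Set (EuclideanSpace ℝ (Fin t))} {r : ℝ} {L : ℝ≥0}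
  {P : EuclideanSpace ℝ (Fin t) → EuclideanSpace ℝ (Fin t)}

/-- **Transfer, Construction 1, for EVERY set `M ⊂ Rᵗ`** (same `c`): the edge `[0, ℓ]` is convex, so `Λ₁` of the extension is
the same in both metrics, and the right-hand side only grows (chord ≤ geodesic). [cite: Federbush1988PhaseCellIV, (11.4) p. 337] -/
theorem geomConstruction1Len_of_geomConstruction1 (h : GeomConstruction1 t M) : GeomConstruction1Len t M := by
  obtain ⟨c, hc⟩ := h
  refine ⟨c, fun ℓ hℓ ga gb => ?_⟩
  obtain ⟨φ, h0, h1, hΛ⟩ := hc ℓ hℓ (ofIntrinsic M ga) (ofIntrinsic M gb)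
  refine ⟨toIntrinsic M ∘ φ, ?_, ?_, ?_⟩
  · rw [Function.comp_apply, h0]; rfl
  · rw [Function.comp_apply, h1]; rfl
  · calc lipConst (toIntrinsic M ∘ φ) ≤ lipConst φ := lipConst_toIntrinsic_comp_le_of_convex (convex_Icc 0 ℓ) φ
      _ ≤ c * edist (ofIntrinsic M ga) (ofIntrinsic M gb) / ENNReal.ofReal ℓ := hΛ
      _ ≤ c * edist ga gb / ENNReal.ofReal ℓ := by
          gcongr
          rw [Subtype.edist_eq, edist_def]
          exact edist_le_intrinsicEDist M _ _

/-- **Transfer, Construction 2, for a uniformly Lipschitz-retractable `M`** (`ε ↦ min(ε, r/(c+1))`, `c ↦ (L+1)c`): (11.5) by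
local quasi-convexity of `M` (retract the chords `[ᵉφ₁(x), ᵉφ₂(x)]`), (11.6) by the convex-domain lemma on the edge.
[cite: Federbush1988PhaseCellIV, (11.5)–(11.6) p. 337; p. 342] -/
theorem geomConstruction2Len_of_retract (hr : 0 < r) (hPL : LipschitzOnWith L P {w | infDist w M < r})
    (hPM : MapsTo P {w | infDist w M < r} M) (hPid : ∀ w ∈ M, P w = w) (h : GeomConstruction2 t M) :
    GeomConstruction2Len t M := by
  obtain ⟨ε, hε, c, H⟩ := h
  set ρ : ℝ≥0 := ⟨r / (c + 1), by positivity⟩ with hρ_def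
  have hρpos : 0 < ρ := by
    rw [← NNReal.coe_pos]; exact div_pos hr (by positivity)
  have hcρ : (c : ℝ) * ρ < 2 * r := by
    have h1 : (c : ℝ) * (r / (c + 1)) ≤ r := by
      rw [mul_div_assoc', div_le_iff₀ (by positivity)]; nlinarith [c.2]
    show (c : ℝ) * (r / (c + 1)) < 2 * r
    linarith
  have hcL : (c : ℝ≥0∞) ≤ ((L + 1) * c : ℝ≥0) := by
    push_cast
    calc (c : ℝ≥0∞) = 1 * c := (one_mul _).symm
      _ ≤ (L + 1) * c := by gcongr; exact le_add_self
  refine ⟨min ε ρ, lt_min hε hρpos, (L + 1) * c, fun ℓ hℓ φ₁ φ₂ eφ₁ hext hδ => ?_⟩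
  set φ₁' : ↥(sphere (0 : EuclideanSpace ℝ (Fin 1)) (ℓ / 2)) → ↥M := ofIntrinsic M ∘ φ₁
  set φ₂' : ↥(sphere (0 : EuclideanSpace ℝ (Fin 1)) (ℓ / 2)) → ↥M := ofIntrinsic M ∘ φ₂
  set eφ₁' : ↥(closedBall (0 : EuclideanSpace ℝ (Fin 1)) (ℓ / 2)) → ↥M := ofIntrinsic M ∘ eφ₁
  have hd' : supDist φ₁' φ₂' ≤ supDist φ₁ φ₂ := supDist_ofIntrinsic_comp_le φ₁ φ₂
  have hΛ₁' : lipConst eφ₁' ≤ lipConst eφ₁ := lipConst_ofIntrinsic_comp_le eφ₁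
  have hΛ₂' : lipConst φ₂' ≤ lipConst φ₂ := lipConst_ofIntrinsic_comp_le φ₂
  obtain ⟨eφ₂', hext', h5, h6⟩ :=
    H ℓ hℓ φ₁' φ₂' eφ₁' (fun x => by simp only [eφ₁', φ₁', Function.comp_apply, hext x])
      (hd'.trans (hδ.trans (by exact_mod_cast min_le_left _ _)))
  refine ⟨toIntrinsic M ∘ eφ₂', fun x => ?_, ?_, ?_⟩
  · rw [Function.comp_apply, hext' x]
    rfl
  · -- (11.5)
    refine iSup_le fun x => ?_
    have hpt : edist (eφ₁' x : EuclideanSpace ℝ (Fin t)) (eφ₂' x) ≤ c * supDist φ₁' φ₂' :=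
      (Subtype.edist_eq _ _).symm.trans_le ((edist_le_supDist eφ₁' eφ₂' x).trans h5)
    have hlt : dist (eφ₁' x : EuclideanSpace ℝ (Fin t)) (eφ₂' x) < 2 * r := by
      have h1 : edist (eφ₁' x : EuclideanSpace ℝ (Fin t)) (eφ₂' x) ≤ ((c * ρ : ℝ≥0) : ℝ≥0∞) := by
        refine hpt.trans ?_
        push_cast
        gcongr
        exact hd'.trans (hδ.trans (by exact_mod_cast min_le_right _ _))
      have h2 : nndist (eφ₁' x : EuclideanSpace ℝ (Fin t)) (eφ₂' x) ≤ c * ρ := edist_le_coe.mp h1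
      calc dist (eφ₁' x : EuclideanSpace ℝ (Fin t)) (eφ₂' x) = nndist (eφ₁' x : EuclideanSpace ℝ (Fin t)) (eφ₂' x) := rfl
        _ ≤ (c : ℝ) * ρ := by exact_mod_cast h2
        _ < 2 * r := hcρ
    calc edist (eφ₁ x) ((toIntrinsic M ∘ eφ₂') x)
        = intrinsicEDist M (eφ₁' x : EuclideanSpace ℝ (Fin t)) (eφ₂' x) := rfl
      _ ≤ L * edist (eφ₁' x : EuclideanSpace ℝ (Fin t)) (eφ₂' x) :=
          intrinsicEDist_le_of_retract hPL hPM hPid (eφ₁' x).2 (eφ₂' x).2 hlt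
      _ ≤ L * (c * supDist φ₁' φ₂') := by gcongr
      _ ≤ (L + 1) * (c * supDist φ₁ φ₂) := by gcongr; exact le_self_add
      _ = ((L + 1) * c : ℝ≥0) * supDist φ₁ φ₂ := by push_cast; ring
  · -- (11.6)
    calc lipConst (toIntrinsic M ∘ eφ₂')
        ≤ lipConst eφ₂' := lipConst_toIntrinsic_comp_le_of_convex (convex_closedBall _ _) eφ₂'
      _ ≤ c * (lipConst eφ₁' + supDist φ₁' φ₂' / ENNReal.ofReal ℓ + lipConst φ₂') := h6
      _ ≤ ((L + 1) * c : ℝ≥0) * (lipConst eφ₁ + supDist φ₁ φ₂ / ENNReal.ofReal ℓ + lipConst φ₂) := by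
          gcongr

open Literature.AlgebraicGeometry.RealAlgebraic Literature.Analysis.Calculus in
/-- **Geometric Construction 1, (11.4), in the INTRINSIC metric for every compact CONNECTED `C^∞` submanifold `M ⊂ Rᵗ`**
(from `geomConstruction1_of_submanifold`, p299964). [cite: Federbush1988PhaseCellIV, (11.4) p. 337] -/
theorem geomConstruction1Len_of_submanifold {d : ℕ} (hMc : IsCompact M) (hconn : IsPreconnected M)
    (hM : IsSubmanifoldOfDim d (EuclideanSpace.equiv (Fin t) ℝ '' M)) : GeomConstruction1Len t M :=
  geomConstruction1Len_of_geomConstruction1 (geomConstruction1_of_submanifold hMc hconn hM)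

open Literature.AlgebraicGeometry.RealAlgebraic Literature.Analysis.Calculus in
/-- **Geometric Construction 2, (11.5)–(11.6), in the INTRINSIC metric for every compact `C^∞` submanifold `M ⊂ Rᵗ`**
(from `geomConstruction2_of_retract`, p264612, with the tubular retraction p299101).
[cite: Federbush1988PhaseCellIV, (11.5)–(11.6) p. 337; p. 342] -/
theorem geomConstruction2Len_of_submanifold {d : ℕ} (hMc : IsCompact M)
    (hM : IsSubmanifoldOfDim d (EuclideanSpace.equiv (Fin t) ℝ '' M)) : GeomConstruction2Len t M := by
  by_cases hne : M.Nonempty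
  · obtain ⟨r, hr, P, -, hPM, hPid, -, L, hPL⟩ := exists_smooth_retraction_euclidean hMc hne hM
    exact geomConstruction2Len_of_retract hr hPL (fun y hy => hPM y hy) hPid
      (geomConstruction2_of_retract hr hPL (fun y hy => hPM y hy) hPid)
  · refine ⟨1, one_pos, 1, fun ℓ hℓ φ₁ _ eφ₁ _ _ => ?_⟩
    exact absurd ⟨_, (ofIntrinsic M (eφ₁ ⟨0, mem_closedBall_self (by positivity)⟩)).2⟩ hne

/-- Constructions 1 and 2 in the intrinsic (great-circle) metric of the MODEL TARGETS `S^{t−1}`, `t ≥ 2` (`U(1) = S¹`,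
`SU(2) = S³`), hypothesis-free. [cite: Federbush1988PhaseCellIV, (11.4)–(11.6) p. 337] -/
theorem geomConstructionsLen_sphere {t : ℕ} (ht : 2 ≤ t) :
    GeomConstruction1Len t (sphere (0 : EuclideanSpace ℝ (Fin t)) 1) ∧
      GeomConstruction2Len t (sphere (0 : EuclideanSpace ℝ (Fin t)) 1) := by
  obtain ⟨hL, hM, hid⟩ := ThmA2.radial_retraction_sphere (le_trans (by norm_num) ht)
  exact ⟨geomConstruction1Len_of_geomConstruction1 (geomConstruction1_sphere ht),
    geomConstruction2Len_of_retract (by norm_num : (0 : ℝ) < 1 / 2) hL hM hid (geomConstruction2_sphere t)⟩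

end GeomConstructions

/-! ## 9. (v1.1) §11 Geometric Constructions 3 and 4, (11.7)–(11.8) and p. 338, in the intrinsic metric; summary bundle -/

section GeomConstructions34

open Intrinsic

/-- The cube `D_ℓ = {0 ≤ x_i ≤ ℓ}` is convex. [cite: Federbush1988PhaseCellIV, Geometric Construction 3 (11.7) p. 338] -/
theorem convex_scaledCube (k : ℕ) (ℓ : ℝ) : Convex ℝ (scaledCube k ℓ) := by
  intro x hx y hy a b ha hb hab i
  have hxi := hx i
  have hyi := hy i
  simp only [PiLp.add_apply, PiLp.smul_apply, smul_eq_mul, mem_Icc]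
  constructor <;> nlinarith [hxi.1, hxi.2, hyi.1, hyi.2]

/-- **Geometric Construction 3, (11.7)–(11.8) p. 338, INTRINSIC METRIC**: «We extend `φ′₁(x)` defined on `∂D` to `ᵉφ′₁(x)` defined
on `D` with `Λ₁(ᵉφ′₁) ≤ cΛ₁(φ′₁)`» at every side `ℓ` under the cap `ℓΛ₁(φ′₁) ≤ c₁` of the p. 339 «Caution» — word for word
`GeomConstruction3` (p299713) with the target `↥M` replaced by `Intrinsic M`. `Prop`-valued definition.
[cite: Federbush1988PhaseCellIV, Geometric Construction 3 (11.7)–(11.8) p. 338; «Caution» p. 339] -/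
def GeomConstruction3Len (k t : ℕ) (M : Set (EuclideanSpace ℝ (Fin t))) : Prop :=
  ∀ c₁ : ℝ≥0, ∃ c : ℝ≥0, ∀ ℓ : ℝ, 0 < ℓ →
    ∀ f : C(↥(scaledCubeBoundary k ℓ), Intrinsic M), f.Nullhomotopic → ENNReal.ofReal ℓ * lipConst f ≤ c₁ →
      ∃ fe : ↥(scaledCube k ℓ) → Intrinsic M,
        (∀ x : ↥(scaledCubeBoundary k ℓ), fe ⟨x.1, scaledCubeBoundary_subset k ℓ x.2⟩ = f x) ∧
        lipConst fe ≤ c * lipConst f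

/-- **Geometric Construction 4, p. 338, INTRINSIC METRIC**: «We extend `φ₂(x)` on `∂D` to `ᵉφ₂(x)` on `D`, satisfying (11.5) and
(11.6)» (`D` the unit `k`-cube) — word for word `GeomConstruction4` (p266275) with the target `↥M` replaced by `Intrinsic M`.
`Prop`-valued definition. [cite: Federbush1988PhaseCellIV, Geometric Construction 4 p. 338; (11.5)–(11.6) p. 337] -/
def GeomConstruction4Len (k t : ℕ) (M : Set (EuclideanSpace ℝ (Fin t))) : Prop :=
  ∃ ε : ℝ≥0, 0 < ε ∧ ∃ c : ℝ≥0,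
    ∀ (φ₁ φ₂ : ↥(cubeBoundary k) → Intrinsic M) (eφ₁ : ↥(unitCube k) → Intrinsic M),
      (∀ x : ↥(cubeBoundary k), eφ₁ ⟨x.1, cubeBoundary_subset k x.2⟩ = φ₁ x) →
      supDist φ₁ φ₂ ≤ ε →
      ∃ eφ₂ : ↥(unitCube k) → Intrinsic M,
        (∀ x : ↥(cubeBoundary k), eφ₂ ⟨x.1, cubeBoundary_subset k x.2⟩ = φ₂ x) ∧
        supDist eφ₁ eφ₂ ≤ c * supDist φ₁ φ₂ ∧
        lipConst eφ₂ ≤ c * (lipConst eφ₁ + supDist φ₁ φ₂ + lipConst φ₂)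

variable {k t : ℕ} {M : Set (EuclideanSpace ℝ (Fin t))} {r : ℝ} {L : ℝ≥0}
  {P : EuclideanSpace ℝ (Fin t) → EuclideanSpace ℝ (Fin t)}

/-- **Transfer, Construction 3, for EVERY set `M ⊂ Rᵗ`** (same `c(c₁)`): cap and null-homotopy by chord ≤ geodesic,
conclusion by the convex-domain lemma on `D_ℓ`. [cite: Federbush1988PhaseCellIV, Geometric Construction 3 (11.7)–(11.8) p. 338] -/
theorem geomConstruction3Len_of_geomConstruction3 (h : GeomConstruction3 k t M) : GeomConstruction3Len k t M := by
  intro c₁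
  obtain ⟨c, hc⟩ := h c₁
  refine ⟨c, fun ℓ hℓ f hf hcap => ?_⟩
  set f' : C(↥(scaledCubeBoundary k ℓ), ↥M) := (ofIntrinsicCM M).comp f with hf'_def
  have hf' : f'.Nullhomotopic := hf.comp_right _
  have hΛ' : lipConst f' ≤ lipConst f := lipConst_ofIntrinsic_comp_le (M := M) f
  obtain ⟨fe', hext, hLip⟩ := hc ℓ hℓ f' hf' (le_trans (by gcongr) hcap)
  refine ⟨toIntrinsic M ∘ fe', fun x => ?_, ?_⟩
  · rw [Function.comp_apply, hext x]
    rfl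
  · calc lipConst (toIntrinsic M ∘ fe') ≤ lipConst fe' :=
          lipConst_toIntrinsic_comp_le_of_convex (convex_scaledCube k ℓ) fe'
      _ ≤ c * lipConst f' := hLip
      _ ≤ c * lipConst f := by gcongr

/-- **Transfer, Construction 4, for a uniformly Lipschitz-retractable `M`** (`ε ↦ min(ε, r/(c+1))`, `c ↦ (L+1)c`): (11.5) on `D`
by local quasi-convexity, (11.6) by the convex-domain lemma on `D`. [cite: Federbush1988PhaseCellIV, Geometric Construction 4 p. 338; p. 342] -/
theorem geomConstruction4Len_of_retract (hr : 0 < r) (hPL : LipschitzOnWith L P {w | infDist w M < r})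
    (hPM : MapsTo P {w | infDist w M < r} M) (hPid : ∀ w ∈ M, P w = w) (h : GeomConstruction4 k t M) :
    GeomConstruction4Len k t M := by
  obtain ⟨ε, hε, c, H⟩ := h
  set ρ : ℝ≥0 := ⟨r / (c + 1), by positivity⟩ with hρ_def
  have hρpos : 0 < ρ := by
    rw [← NNReal.coe_pos]; exact div_pos hr (by positivity)
  have hcρ : (c : ℝ) * ρ < 2 * r := by
    have h1 : (c : ℝ) * (r / (c + 1)) ≤ r := by
      rw [mul_div_assoc', div_le_iff₀ (by positivity)]; nlinarith [c.2]
    show (c : ℝ) * (r / (c + 1)) < 2 * r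
    linarith
  refine ⟨min ε ρ, lt_min hε hρpos, (L + 1) * c, fun φ₁ φ₂ eφ₁ hext hδ => ?_⟩
  set φ₁' : ↥(cubeBoundary k) → ↥M := ofIntrinsic M ∘ φ₁
  set φ₂' : ↥(cubeBoundary k) → ↥M := ofIntrinsic M ∘ φ₂
  set eφ₁' : ↥(unitCube k) → ↥M := ofIntrinsic M ∘ eφ₁
  have hd' : supDist φ₁' φ₂' ≤ supDist φ₁ φ₂ := supDist_ofIntrinsic_comp_le φ₁ φ₂
  have hΛ₁' : lipConst eφ₁' ≤ lipConst eφ₁ := lipConst_ofIntrinsic_comp_le eφ₁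
  have hΛ₂' : lipConst φ₂' ≤ lipConst φ₂ := lipConst_ofIntrinsic_comp_le φ₂
  obtain ⟨eφ₂', hext', h5, h6⟩ :=
    H φ₁' φ₂' eφ₁' (fun x => by simp only [eφ₁', φ₁', Function.comp_apply, hext x])
      (hd'.trans (hδ.trans (by exact_mod_cast min_le_left _ _)))
  refine ⟨toIntrinsic M ∘ eφ₂', fun x => ?_, ?_, ?_⟩
  · rw [Function.comp_apply, hext' x]
    rfl
  · refine iSup_le fun x => ?_
    have hpt : edist (eφ₁' x : EuclideanSpace ℝ (Fin t)) (eφ₂' x) ≤ c * supDist φ₁' φ₂' :=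
      (Subtype.edist_eq _ _).symm.trans_le ((edist_le_supDist eφ₁' eφ₂' x).trans h5)
    have hlt : dist (eφ₁' x : EuclideanSpace ℝ (Fin t)) (eφ₂' x) < 2 * r := by
      have h1 : edist (eφ₁' x : EuclideanSpace ℝ (Fin t)) (eφ₂' x) ≤ ((c * ρ : ℝ≥0) : ℝ≥0∞) := by
        refine hpt.trans ?_
        push_cast
        gcongr
        exact hd'.trans (hδ.trans (by exact_mod_cast min_le_right _ _))
      have h2 : nndist (eφ₁' x : EuclideanSpace ℝ (Fin t)) (eφ₂' x) ≤ c * ρ := edist_le_coe.mp h1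
      calc dist (eφ₁' x : EuclideanSpace ℝ (Fin t)) (eφ₂' x) = nndist (eφ₁' x : EuclideanSpace ℝ (Fin t)) (eφ₂' x) := rfl
        _ ≤ (c : ℝ) * ρ := by exact_mod_cast h2
        _ < 2 * r := hcρ
    calc edist (eφ₁ x) ((toIntrinsic M ∘ eφ₂') x)
        = intrinsicEDist M (eφ₁' x : EuclideanSpace ℝ (Fin t)) (eφ₂' x) := rfl
      _ ≤ L * edist (eφ₁' x : EuclideanSpace ℝ (Fin t)) (eφ₂' x) :=
          intrinsicEDist_le_of_retract hPL hPM hPid (eφ₁' x).2 (eφ₂' x).2 hlt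
      _ ≤ L * (c * supDist φ₁' φ₂') := by gcongr
      _ ≤ (L + 1) * (c * supDist φ₁ φ₂) := by gcongr; exact le_self_add
      _ = ((L + 1) * c : ℝ≥0) * supDist φ₁ φ₂ := by push_cast; ring
  · calc lipConst (toIntrinsic M ∘ eφ₂')
        ≤ lipConst eφ₂' := lipConst_toIntrinsic_comp_le_of_convex (convex_unitCube k) eφ₂'
      _ ≤ c * (lipConst eφ₁' + supDist φ₁' φ₂' + lipConst φ₂') := h6
      _ ≤ ((L + 1) * c : ℝ≥0) * (lipConst eφ₁ + supDist φ₁ φ₂ + lipConst φ₂) := by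
          push_cast
          gcongr
          calc (c : ℝ≥0∞) = 1 * c := (one_mul _).symm
            _ ≤ (L + 1) * c := by gcongr; exact le_add_self

open Literature.AlgebraicGeometry.RealAlgebraic Literature.Analysis.Calculus in
/-- **Construction 3 in the INTRINSIC metric for every compact `C^∞` submanifold `M ⊂ Rᵗ`**, every cube dimension `k`
(from `geomConstruction3_of_submanifold`, p312819). [cite: Federbush1988PhaseCellIV, Geometric Construction 3 (11.7)–(11.8) p. 338] -/
theorem geomConstruction3Len_of_submanifold {d : ℕ} (hMc : IsCompact M)
    (hM : IsSubmanifoldOfDim d (EuclideanSpace.equiv (Fin t) ℝ '' M)) (k : ℕ) : GeomConstruction3Len k t M :=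
  geomConstruction3Len_of_geomConstruction3 (geomConstruction3_of_submanifold hMc hM k)

open Literature.AlgebraicGeometry.RealAlgebraic Literature.Analysis.Calculus in
/-- **Construction 4 in the INTRINSIC metric for every compact `C^∞` submanifold `M ⊂ Rᵗ`**, every cube dimension `k`
(from `geomConstruction4_of_retract`, p266275, with the tubular retraction p299101).
[cite: Federbush1988PhaseCellIV, Geometric Construction 4 p. 338; p. 342] -/
theorem geomConstruction4Len_of_submanifold {d : ℕ} (hMc : IsCompact M)
    (hM : IsSubmanifoldOfDim d (EuclideanSpace.equiv (Fin t) ℝ '' M)) (k : ℕ) : GeomConstruction4Len k t M := by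
  by_cases hne : M.Nonempty
  · obtain ⟨r, hr, P, -, hPM, hPid, -, L, hPL⟩ := exists_smooth_retraction_euclidean hMc hne hM
    exact geomConstruction4Len_of_retract hr hPL (fun y hy => hPM y hy) hPid
      (geomConstruction4_of_retract hr hPL (fun y hy => hPM y hy) hPid)
  · refine ⟨1, one_pos, 1, fun φ₁ φ₂ eφ₁ _ _ => ?_⟩
    by_cases hk : (unitCube k).Nonempty
    · obtain ⟨x, hx⟩ := hk
      exact absurd ⟨_, (ofIntrinsic M (eφ₁ ⟨x, hx⟩)).2⟩ hne
    · refine ⟨eφ₁, fun x => absurd ⟨x.1, cubeBoundary_subset k x.2⟩ hk, ?_, ?_⟩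
      · refine iSup_le fun x => absurd ⟨x.1, x.2⟩ hk
      · refine (iSup_le fun x => absurd ⟨x.1, x.2⟩ hk).trans bot_le

open Literature.AlgebraicGeometry.RealAlgebraic Literature.Analysis.Calculus in
/-- **Summary.** For every compact CONNECTED `C^∞` submanifold `M ⊂ Rᵗ` EQUIPPED WITH ITS INTRINSIC (Riemannian) DISTANCE and
every cube/ball dimension `n`: Theorems A.1 (every cap), A.2 and §11 Geometric Constructions 1, 2, 3, 4 of
[Federbush1988PhaseCellIV] all hold. [cite: Federbush1988PhaseCellIV, Theorems A.1–A.2 pp. 339–341; (11.4)–(11.8) pp. 337–338] -/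
theorem appA12_and_geomConstructions1234Len_of_submanifold {d : ℕ} (hMc : IsCompact M) (hconn : IsPreconnected M)
    (hM : IsSubmanifoldOfDim d (EuclideanSpace.equiv (Fin t) ℝ '' M)) (n : ℕ) :
    ThmA1Len n t M ∧ ThmA2Len n t M ∧ GeomConstruction1Len t M ∧ GeomConstruction2Len t M ∧
      GeomConstruction3Len n t M ∧ GeomConstruction4Len n t M :=
  ⟨thmA1Len_of_submanifold hMc hM n, thmA2Len_of_submanifold hMc hM n, geomConstruction1Len_of_submanifold hMc hconn hM,
    geomConstruction2Len_of_submanifold hMc hM, geomConstruction3Len_of_submanifold hMc hM n,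
    geomConstruction4Len_of_submanifold hMc hM n⟩

end GeomConstructions34

/-! ## 10. (v1.3, append-only) The RECORD decls `ThmA1 n I M`, `ThmA2 n I M` (abstract compact Riemannian manifold) under an
explicit isometric-embedding hypothesis -/

section Record

open scoped ContDiff Manifold
open Intrinsic Bundle

variable {X Y Z : Type*} [PseudoEMetricSpace X] [PseudoEMetricSpace Y] [PseudoEMetricSpace Z]

/-- `Λ₁` is unchanged by post-composition with an isometry. [cite: Federbush1988PhaseCellIV, (11.4) p. 337] -/
theorem lipConst_comp_isometry {ψ : Y → Z} (hψ : Isometry ψ) (φ : X → Y) : lipConst (ψ ∘ φ) = lipConst φ := by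
  simp only [lipConst, Function.comp_apply, hψ.edist_eq]

/-- `d^M` is unchanged by post-composition with an isometry. [cite: Federbush1988PhaseCellIV, (A.17) p. 341] -/
theorem supDist_comp_isometry {W : Type*} {ψ : Y → Z} (hψ : Isometry ψ) (g₁ g₂ : W → Y) :
    supDist (ψ ∘ g₁) (ψ ∘ g₂) = supDist g₁ g₂ := by
  simp only [supDist, Function.comp_apply, hψ.edist_eq]

variable {M : Type*} {t : ℕ}

/-- The corestriction `M → (e(M), d)` of a map `e : M → Rᵗ` to the intrinsic copy of its image («We now embed `M` in some
Euclidean space `Rᵗ`», p. 342). [cite: Federbush1988PhaseCellIV, p. 342] -/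
def toIntrinsicRange (e : M → EuclideanSpace ℝ (Fin t)) (x : M) : Intrinsic (range e) :=
  toIntrinsic (range e) ⟨e x, mem_range_self x⟩

/-- Unfolding lemma. [cite: Federbush1988PhaseCellIV, p. 342] -/
@[simp] theorem coe_ofIntrinsic_toIntrinsicRange (e : M → EuclideanSpace ℝ (Fin t)) (x : M) :
    ((ofIntrinsic (range e) (toIntrinsicRange e x) : ↥(range e)) : EuclideanSpace ℝ (Fin t)) = e x := rfl

/-- A right inverse `(e(M), d) → M` of the corestriction (a choice of preimage). [cite: Federbush1988PhaseCellIV, p. 342] -/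
def ofIntrinsicRange (e : M → EuclideanSpace ℝ (Fin t)) (p : Intrinsic (range e)) : M :=
  Classical.choose (ofIntrinsic (range e) p).2

/-- `e (ofIntrinsicRange e p) = p`. [cite: Federbush1988PhaseCellIV, p. 342] -/
theorem apply_ofIntrinsicRange (e : M → EuclideanSpace ℝ (Fin t)) (p : Intrinsic (range e)) :
    e (ofIntrinsicRange e p) = ((ofIntrinsic (range e) p : ↥(range e)) : EuclideanSpace ℝ (Fin t)) :=
  Classical.choose_spec (ofIntrinsic (range e) p).2

/-- `toIntrinsicRange e ∘ ofIntrinsicRange e = id`. [cite: Federbush1988PhaseCellIV, p. 342] -/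
theorem toIntrinsicRange_ofIntrinsicRange (e : M → EuclideanSpace ℝ (Fin t)) (p : Intrinsic (range e)) :
    toIntrinsicRange e (ofIntrinsicRange e p) = p := by
  apply Subtype.ext
  exact apply_ofIntrinsicRange e p

/-- **An isometric embedding in the METRIC sense**: a map `e : M → Rᵗ` of an (extended pseudo-)metric space `M` — print's
abstract «compact differentiable manifold (without boundary) … provided with a Riemannian metric» of Theorems A.1/A.2, i.e. the
record context of `ThmA1`/`ThmA2` (p242861), where `edist` IS the Riemannian distance (`IsRiemannianManifold`) — whose image is an
embedded `C^∞` submanifold of dimension `d` (read in coordinates; compactness is not part of the structure — it comes from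
`CompactSpace M`, see `IsMetricEmbedding.isCompact_range`) and which carries the distance of `M` onto the INTRINSIC distance
`intrinsicEDist (range e)` of the image.  By the Nash (1956) / Günther (1989) isometric embedding theorem every compact
Riemannian manifold admits such an `e` (a `C^∞` isometric embedding preserves the lengths of curves, hence identifies the
Riemannian distance with the induced length metric of the image); that theorem is NOT formalised — here the embedding is an
explicit HYPOTHESIS, the shape in which print uses it: «We now embed `M` in some Euclidean space `Rᵗ`» (p. 342).
[cite: Federbush1988PhaseCellIV, Theorem A.1 p. 339; p. 342] -/
structure IsMetricEmbedding [PseudoEMetricSpace M] (d : ℕ) (e : M → EuclideanSpace ℝ (Fin t)) : Prop where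
  /-- the image is an embedded `C^∞` submanifold of `Rᵗ` of dimension `d` (in coordinates `EuclideanSpace.equiv`) -/
  submanifold : Literature.AlgebraicGeometry.RealAlgebraic.IsSubmanifoldOfDim d (EuclideanSpace.equiv (Fin t) ℝ '' range e)
  /-- `e` carries the distance of `M` onto the intrinsic distance of its image -/
  edist_eq : ∀ x y : M, edist x y = intrinsicEDist (range e) (e x) (e y)

namespace IsMetricEmbedding

section Pseudo

variable [PseudoEMetricSpace M] {d : ℕ} {e : M → EuclideanSpace ℝ (Fin t)}

/-- The corestriction `M → (e(M), d)` is an isometry. [cite: Federbush1988PhaseCellIV, p. 342] -/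
theorem isometry_toIntrinsicRange (h : IsMetricEmbedding d e) : Isometry (toIntrinsicRange e) :=
  fun x y => (h.edist_eq x y).symm

/-- `e` is `1`-Lipschitz into `Rᵗ` (chord ≤ geodesic). [cite: Federbush1988PhaseCellIV, p. 342] -/
theorem lipschitzWith (h : IsMetricEmbedding d e) : LipschitzWith 1 e := fun x y => by
  rw [ENNReal.coe_one, one_mul, h.edist_eq x y]
  exact edist_le_intrinsicEDist _ _ _

/-- … hence continuous. [cite: Federbush1988PhaseCellIV, p. 342] -/
theorem continuous (h : IsMetricEmbedding d e) : Continuous e := h.lipschitzWith.continuous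

/-- The image of a compact `M` is compact. [cite: Federbush1988PhaseCellIV, p. 342] -/
theorem isCompact_range [CompactSpace M] (h : IsMetricEmbedding d e) : IsCompact (range e) :=
  _root_.isCompact_range h.continuous

/-- The chosen right inverse `(e(M), d) → M` is an isometry too. [cite: Federbush1988PhaseCellIV, p. 342] -/
theorem isometry_ofIntrinsicRange (h : IsMetricEmbedding d e) : Isometry (ofIntrinsicRange e) :=
  h.isometry_toIntrinsicRange.right_inv (toIntrinsicRange_ofIntrinsicRange e)

end Pseudo

section Emetric

variable [EMetricSpace M] {d : ℕ} {e : M → EuclideanSpace ℝ (Fin t)}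

/-- On an extended METRIC space `e` is injective. [cite: Federbush1988PhaseCellIV, p. 342] -/
theorem injective (h : IsMetricEmbedding d e) : Function.Injective e := fun _ _ hxy =>
  h.isometry_toIntrinsicRange.injective (Subtype.ext hxy)

/-- `ofIntrinsicRange e ∘ toIntrinsicRange e = id`. [cite: Federbush1988PhaseCellIV, p. 342] -/
theorem ofIntrinsicRange_toIntrinsicRange (h : IsMetricEmbedding d e) (x : M) :
    ofIntrinsicRange e (toIntrinsicRange e x) = x :=
  h.injective (apply_ofIntrinsicRange e (toIntrinsicRange e x))

/-- (v1.4) For compact `M`, `e` is a closed topological embedding `M → Rᵗ` for the AMBIENT topology of `Rᵗ` as well — print՚s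
«We now embed `M` in some Euclidean space `Rᵗ`» (p. 342) in both senses. [cite: Federbush1988PhaseCellIV, p. 342] -/
theorem isClosedEmbedding [CompactSpace M] (h : IsMetricEmbedding d e) : Topology.IsClosedEmbedding e :=
  h.continuous.isClosedEmbedding h.injective

/-- (v1.4) … hence a compact `M` is HOMEOMORPHIC to its image `e(M) ⊂ Rᵗ` carrying the AMBIENT topology, by `e` itself: the
hypothesis «homotopically trivial» of Theorem A.1 reads the same for `f : ∂D → M` and for `e ∘ f : ∂D → e(M) ⊂ Rᵗ` (the embedded
reading `ThmA1Emb`). [cite: Federbush1988PhaseCellIV, Theorem A.1 p. 339; p. 342] -/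
def homeomorphRange [CompactSpace M] (h : IsMetricEmbedding d e) : M ≃ₜ ↥(range e) :=
  h.isClosedEmbedding.isEmbedding.toHomeomorph

/-- Unfolding lemma. [cite: Federbush1988PhaseCellIV, p. 342] -/
@[simp] theorem coe_homeomorphRange_apply [CompactSpace M] (h : IsMetricEmbedding d e) (x : M) :
    ((h.homeomorphRange x : ↥(range e)) : EuclideanSpace ℝ (Fin t)) = e x := rfl

end Emetric

open Literature.AlgebraicGeometry.RealAlgebraic in
/-- NON-VACUITY, the model case: the inclusion of a `C^∞` submanifold `M ⊂ Rᵗ` carrying its INTRINSIC distance (the type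
`Intrinsic M`) is a metric embedding. [cite: Federbush1988PhaseCellIV, p. 342] -/
theorem inclusion {M : Set (EuclideanSpace ℝ (Fin t))} {d : ℕ} (hM : IsSubmanifoldOfDim d (EuclideanSpace.equiv (Fin t) ℝ '' M)) :
    IsMetricEmbedding d (fun p : Intrinsic M => ((ofIntrinsic M p : ↥M) : EuclideanSpace ℝ (Fin t))) := by
  have hr : range (fun p : Intrinsic M => ((ofIntrinsic M p : ↥M) : EuclideanSpace ℝ (Fin t))) = M := by
    ext x
    exact ⟨fun ⟨p, hp⟩ => hp ▸ (ofIntrinsic M p).2, fun hx => ⟨toIntrinsic M ⟨x, hx⟩, rfl⟩⟩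
  refine ⟨by rwa [hr], fun x y => ?_⟩
  rw [hr]
  rfl

end IsMetricEmbedding

variable {E : Type*} [NormedAddCommGroup E] [NormedSpace ℝ E] {H : Type*} [TopologicalSpace H] (J : ModelWithCorners ℝ E H)
  [EMetricSpace M] [ChartedSpace H M] [IsManifold J ∞ M] [RiemannianBundle (fun (x : M) ↦ TangentSpace J x)]
  [IsContMDiffRiemannianBundle J ∞ E (fun (x : M) ↦ TangentSpace J x)] [IsRiemannianManifold J M] [CompactSpace M]
  [BoundarylessManifold J M] {d : ℕ} {e : M → EuclideanSpace ℝ (Fin t)}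

/-- **The RECORD decl `ThmA1 n J M` (Theorem A.1 for an abstract compact Riemannian manifold, p242861) HOLDS for every `M` that
embeds isometrically — as a metric space — onto a compact `C^∞` submanifold of some `Rᵗ` with its intrinsic metric** (every cap
`c₁`, every cube dimension `n`): transport of `thmA1Len_of_submanifold` along the isometry `M ≃ (e(M), d)` (`Λ₁` and extensions
are invariant under isometries onto).  By Nash–Günther the hypothesis is met by every compact Riemannian manifold (not
formalised; cf. cell ruling G.5-49 (c)). [cite: Federbush1988PhaseCellIV, Theorem A.1 (A.1)–(A.2) p. 339; p. 342] -/
theorem thmA1_of_isMetricEmbedding (h : IsMetricEmbedding d e) (n : ℕ) : ThmA1 n J M := by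
  intro c₁
  obtain ⟨c₂, hc⟩ := thmA1Len_of_submanifold h.isCompact_range h.submanifold n c₁
  refine ⟨c₂, fun f hf hΛ => ?_⟩
  set ê : C(M, Intrinsic (range e)) := ⟨toIntrinsicRange e, h.isometry_toIntrinsicRange.continuous⟩ with hê_def
  have hΛ' : lipConst (ê.comp f) = lipConst f := lipConst_comp_isometry h.isometry_toIntrinsicRange f
  obtain ⟨g, hext, hLip⟩ := hc (ê.comp f) (hf.comp_right ê) (hΛ'.le.trans hΛ)
  refine ⟨ofIntrinsicRange e ∘ g, fun x => ?_, ?_⟩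
  · rw [Function.comp_apply, hext x]
    exact h.ofIntrinsicRange_toIntrinsicRange (f x)
  · rw [lipConst_comp_isometry h.isometry_ofIntrinsicRange, ← hΛ']
    exact hLip

/-- **The RECORD decl `ThmA2 n J M` (Theorem A.2 for an abstract compact Riemannian manifold, p242861) HOLDS for every `M` that
embeds isometrically (metric sense) onto a compact `C^∞` submanifold of some `Rᵗ` with its intrinsic metric** (every ball
dimension `n`; the constants `ε_M, c₁, c₂` of `thmA2Len_of_submanifold` for the image): `d^M`, `Λ₁` and extensions are invariant
under isometries onto. [cite: Federbush1988PhaseCellIV, Theorem A.2 (A.17)–(A.19) p. 341; p. 342] -/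
theorem thmA2_of_isMetricEmbedding (h : IsMetricEmbedding d e) (n : ℕ) : ThmA2 n J M := by
  obtain ⟨εM, hε, c₁, c₂, H⟩ := thmA2Len_of_submanifold h.isCompact_range h.submanifold n
  refine ⟨εM, hε, c₁, c₂, fun f₁ f₂ f₁e hext hδ => ?_⟩
  have hι := h.isometry_toIntrinsicRange
  have hd : supDist (toIntrinsicRange e ∘ f₁) (toIntrinsicRange e ∘ f₂) = supDist f₁ f₂ := supDist_comp_isometry hι f₁ f₂
  obtain ⟨g, hext', h18, h19⟩ := H (toIntrinsicRange e ∘ f₁) (toIntrinsicRange e ∘ f₂) (toIntrinsicRange e ∘ f₁e)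
    (fun x => by simp only [Function.comp_apply, hext x]) (hd.le.trans hδ)
  have hg : g = toIntrinsicRange e ∘ (ofIntrinsicRange e ∘ g) :=
    funext fun x => (toIntrinsicRange_ofIntrinsicRange e (g x)).symm
  refine ⟨ofIntrinsicRange e ∘ g, fun x => ?_, ?_, ?_⟩
  · rw [Function.comp_apply, hext' x]
    exact h.ofIntrinsicRange_toIntrinsicRange (f₂ x)
  · rw [← supDist_comp_isometry hι f₁e (ofIntrinsicRange e ∘ g), ← hg, ← hd]
    exact h18
  · rw [← lipConst_comp_isometry hι (ofIntrinsicRange e ∘ g), ← hg, ← hd, ← lipConst_comp_isometry hι f₁e,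
      ← lipConst_comp_isometry hι f₂]
    exact h19

end Record

/-! ## 11. (v1.4, append-only) Theorems A.3 and A.4 — the capped continuous re-typings of record `ThmA3ContCap` /
`ThmA4ContCap` (rows F4.ThmA.3 / F4.ThmA.4) — with `Λ₁(f)` in print's INTRINSIC metric of `M` -/

section ThmA34Len

open scoped ContDiff
open Intrinsic

/-- **Theorem A.3, capped continuous form, with `Λ₁(f)` in print's metric**: the decl of record `ThmA3ContCap n t M` (p261759;
PROVED for every compact `C^∞` submanifold, p299476) word for word, except that the datum is `f : B → (M, d)` (the type
`Intrinsic M`) and its Lipschitz constants `K` — the `Λ₁(f)` of (A.26) — are taken in print's Riemannian (= induced length)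
distance `d` of `M` («`M`, a compact differentiable manifold (without boundary) equipped with a metric», p. 342).  The
conclusion (A.25)–(A.26) is about the ambient map `f^s : B → Rᵗ` with values in `M` (derivative bounds are extrinsic by nature:
«We now embed `M` in some Euclidean space `Rᵗ`, and view `f` as a map from `B` into `Rᵗ`», p. 342) and is unchanged.
[cite: Federbush1988PhaseCellIV, Theorem A.3 (A.25)–(A.26) p. 342; «Caution» p. 339] -/
def ThmA3LenCap (n t : ℕ) (M : Set (EuclideanSpace ℝ (Fin t))) : Prop :=
  ∀ c₁ : ℝ≥0, ∃ c : ℕ → ℝ, ∀ f : ↥(closedBall (0 : EuclideanSpace ℝ (Fin n)) 1) → Intrinsic M,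
    (∃ K : ℝ≥0, K ≤ c₁ ∧ LipschitzWith K f) →
    ∃ fs : EuclideanSpace ℝ (Fin n) → EuclideanSpace ℝ (Fin t),
      MapsTo fs (closedBall 0 1) M ∧
      (∀ x : ↥(sphere (0 : EuclideanSpace ℝ (Fin n)) 1),
        fs x = ((ofIntrinsic M (f ⟨x.1, sphere_subset_closedBall x.2⟩) : ↥M) : EuclideanSpace ℝ (Fin t))) ∧
      ContinuousOn fs (closedBall 0 1) ∧
      ContDiffOn ℝ ∞ fs (ball 0 1) ∧
      ∀ m : ℕ, 1 ≤ m → ∀ K : ℝ≥0, K ≤ c₁ → LipschitzWith K f →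
        ∀ x ∈ ball (0 : EuclideanSpace ℝ (Fin n)) 1,
          ‖iteratedFDeriv ℝ m fs x‖ ≤
            c m * ((infDist x (sphere (0 : EuclideanSpace ℝ (Fin n)) 1))⁻¹ ^ (m - 1)) * K

/-- **Theorem A.4, capped continuous form, with `Λ₁(f)` in print's metric**: `ThmA4ContCap n t M` (p262634; PROVED for every
compact `C^∞` submanifold, p299476) with the boundary datum `f : ∂B → (M, d)` and its Lipschitz constants in print's distance
`d`; conclusion (A.34)–(A.36) unchanged. [cite: Federbush1988PhaseCellIV, Theorem A.4 (A.32)–(A.36) pp. 342–343; «Caution» p. 339] -/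
def ThmA4LenCap (n t : ℕ) (M : Set (EuclideanSpace ℝ (Fin t))) : Prop :=
  ∀ c₁ : ℝ≥0, ∃ c : ℕ → ℝ, ∀ (x₀ : EuclideanSpace ℝ (Fin n)) (f : ↥(sphere x₀ 1) → Intrinsic M),
    (∃ K : ℝ≥0, K ≤ c₁ ∧ LipschitzWith K f) →
    ∃ fes : EuclideanSpace ℝ (Fin n) → EuclideanSpace ℝ (Fin t),
      MapsTo fes (closedBall x₀ 1 \ {x₀}) M ∧
      (∀ x : ↥(sphere x₀ 1), fes x = ((ofIntrinsic M (f x) : ↥M) : EuclideanSpace ℝ (Fin t))) ∧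
      ContinuousOn fes (closedBall x₀ 1 \ {x₀}) ∧
      ContDiffOn ℝ ∞ fes (ball x₀ 1 \ {x₀}) ∧
      ∀ m : ℕ, 1 ≤ m → ∀ K : ℝ≥0, K ≤ c₁ → LipschitzWith K f →
        ∀ x ∈ ball x₀ 1 \ {x₀},
          ‖iteratedFDeriv ℝ m fes x‖ ≤
            c m * ((infDist x (sphere x₀ 1 ∪ {x₀}))⁻¹ ^ (m - 1)) * ‖x - x₀‖⁻¹ * K

variable {n t : ℕ} {M : Set (EuclideanSpace ℝ (Fin t))}

/-- A `K`-Lipschitz map into `(M, d)` is `K`-Lipschitz into `M ⊂ Rᵗ` (chord ≤ geodesic). [cite: Federbush1988PhaseCellIV, (11.4) p. 337] -/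
theorem lipschitzWith_ofIntrinsic_comp {X : Type*} [PseudoEMetricSpace X] {K : ℝ≥0} {f : X → Intrinsic M}
    (hf : LipschitzWith K f) : LipschitzWith K (ofIntrinsic M ∘ f) := by
  simpa only [one_mul] using lipschitzWith_ofIntrinsic.comp hf

/-- **`ThmA3ContCap ⇒ ThmA3LenCap` for EVERY set `M`, with the same constants**: a Riemannian Lipschitz bound is a chordal one,
and the conclusion does not involve the metric of `M`. [cite: Federbush1988PhaseCellIV, Theorem A.3 (A.25)–(A.26) p. 342] -/
theorem thmA3LenCap_of_thmA3ContCap (h : ThmA3ContCap n t M) : ThmA3LenCap n t M := by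
  intro c₁
  obtain ⟨c, hc⟩ := h c₁
  refine ⟨c, fun f hf => ?_⟩
  obtain ⟨K, hK, hfK⟩ := hf
  obtain ⟨fs, h1, h2, h3, h4, h5⟩ := hc (ofIntrinsic M ∘ f) ⟨K, hK, lipschitzWith_ofIntrinsic_comp hfK⟩
  exact ⟨fs, h1, fun x => h2 x, h3, h4, fun m hm K' hK' hf' x hx => h5 m hm K' hK' (lipschitzWith_ofIntrinsic_comp hf') x hx⟩

/-- **`ThmA4ContCap ⇒ ThmA4LenCap` for EVERY set `M`, with the same constants.**
[cite: Federbush1988PhaseCellIV, Theorem A.4 (A.34)–(A.36) p. 343] -/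
theorem thmA4LenCap_of_thmA4ContCap (h : ThmA4ContCap n t M) : ThmA4LenCap n t M := by
  intro c₁
  obtain ⟨c, hc⟩ := h c₁
  refine ⟨c, fun x₀ f hf => ?_⟩
  obtain ⟨K, hK, hfK⟩ := hf
  obtain ⟨fes, h1, h2, h3, h4, h5⟩ := hc x₀ (ofIntrinsic M ∘ f) ⟨K, hK, lipschitzWith_ofIntrinsic_comp hfK⟩
  exact ⟨fes, h1, fun x => h2 x, h3, h4, fun m hm K' hK' hf' x hx => h5 m hm K' hK' (lipschitzWith_ofIntrinsic_comp hf') x hx⟩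

open Literature.AlgebraicGeometry.RealAlgebraic in
/-- **Theorems A.3 and A.4 (capped, continuous) with print's `Λ₁` for every compact `C^∞` submanifold `M ⊂ Rᵗ`** (from
`thmA3ContCap_of_submanifold` / `thmA4ContCap_of_submanifold`, p299476). [cite: Federbush1988PhaseCellIV, Theorems A.3–A.4 pp. 342–343] -/
theorem thmA3LenCap_and_thmA4LenCap_of_submanifold {d : ℕ} (hMc : IsCompact M)
    (hM : IsSubmanifoldOfDim d (EuclideanSpace.equiv (Fin t) ℝ '' M)) (n : ℕ) : ThmA3LenCap n t M ∧ ThmA4LenCap n t M :=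
  ⟨thmA3LenCap_of_thmA3ContCap (thmA3ContCap_of_submanifold hMc hM n),
    thmA4LenCap_of_thmA4ContCap (thmA4ContCap_of_submanifold hMc hM n)⟩

/-- … and hypothesis-free for the model targets `S^{t−1}` (`U(1) = S¹`, `SU(2) = S³`).
[cite: Federbush1988PhaseCellIV, Theorems A.3–A.4 pp. 342–343] -/
theorem thmA3LenCap_and_thmA4LenCap_sphere (n t : ℕ) :
    ThmA3LenCap n t (sphere (0 : EuclideanSpace ℝ (Fin t)) 1) ∧ ThmA4LenCap n t (sphere (0 : EuclideanSpace ℝ (Fin t)) 1) :=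
  ⟨thmA3LenCap_of_thmA3ContCap (Retract.thmA3ContCap_sphere n t), thmA4LenCap_of_thmA4ContCap (Retract.thmA4ContCap_sphere n t)⟩

open Literature.AlgebraicGeometry.RealAlgebraic in
/-- **ALL FOUR theorems of Appendix A in print's metric, for every compact `C^∞` submanifold `M ⊂ Rᵗ`**: A.1 (`ThmA1Len`, every
cap), A.2 (`ThmA2Len`), A.3 (`ThmA3LenCap`), A.4 (`ThmA4LenCap`). [cite: Federbush1988PhaseCellIV, Appendix A, Theorems A.1–A.4 pp. 339–343] -/
theorem appA_len_of_submanifold {d : ℕ} (hMc : IsCompact M) (hM : IsSubmanifoldOfDim d (EuclideanSpace.equiv (Fin t) ℝ '' M))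
    (n : ℕ) : ThmA1Len n t M ∧ ThmA2Len n t M ∧ ThmA3LenCap n t M ∧ ThmA4LenCap n t M :=
  ⟨thmA1Len_of_submanifold hMc hM n, thmA2Len_of_submanifold hMc hM n, thmA3LenCap_and_thmA4LenCap_of_submanifold hMc hM n⟩

end ThmA34Len


end PhaseCellIVAppA

end

end Literature.MathematicalPhysics.QuantumFieldTheory.Federbush1986
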